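/-
Copyright (c) 2026 the pub-hodgecm-mathlib formalisation cell (harness21).  Prover seat hodgecm-mathlib-K2Liu-p27 (g0), Track B «K2-LIT»,
hLiu418 = stmt-HodgeConjecture-24832; #41 (β) Euler face (E4) GK SPHERICAL VALUE, cut of K2E5-p16 (g8) 2026-09-04T16:28:52Z, file (F-GK-2s) (split place).
-/
import Summits.HodgeConjecture.HodgeConjecture.Theorems.K2LiuA7NormalisedRegularitySplit    -- ★ B7s (`integrable_of_norm_le_mul`, + the whole cocycle tower)
import Summits.HodgeConjecture.HodgeConjecture.Theorems.K2LiuRankOneSphericalStage          -- ★ (F-GK-1) `integrable_and_integral_eq_of_level_zero` (K2E5-p16)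
import HarnessLib

/-!
# Crux `HLiu418`, #41 (β) Euler face, (E4) file (F-GK-2s): THE SPHERICAL VALUE OF THE SIEGEL INTERTWINING COCYCLE AT A SPLIT PLACE
# `M_v(s) f (h) = χ_s(m₀) · ν_N(BOX) · Π_i (1 + Cᵢ (1 − qᵢ⁻¹) αᵢ qᵢ^{1−eᵢ} L(eᵢ−1, νᵢ)) · f(h)` (`h ∈ K₀`, four level-0 stages) `= aNorm 2 χ_v ν_N(BOX) s · f(h)` at a good place

HEADS (split twins of ★ (F-GK-2) `K2LiuSiegelCocycleSphericalValue`, K2E5-p16 (g8), same letters with `(w₁ w₂ hne hw) (A₁ hA₁ A₂ hA₂)`): §1 `measureReal_box_eq_of_pair`;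
§2 `localIntertwining_eq_of_spherical_of_pair_coord` (explicit coordinates ∕ measures) and `localIntertwining_eq_of_spherical_of_pair` (intrinsic, `ν_N(BOX)`);
§3 `localIntertwining_eq_aNorm_mul_of_spherical_of_pair` (`hm₀ hC₁ hC₂₁ hC₂₂ hC₃` ⇒ `aNorm 2 χ_v (ν_N.real BOX) s · f h`, ★ T1 `aNorm_two` + `lEN = L_{w₁}·L_{w₂}`).

Cell `hodgecm-mathlib`, crux item hLiu418 = `stmt-HodgeConjecture-24832`; squad K2 ∕ K2Liu; LEAD F0P6-plan (g14) BATCH #53 (2); (E4) lead hand K2E5-p16 (g8), second hand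
K2Liu-p27 (g0) (this file), desk K2Liu-p13 (g4).  THEOREMS ONLY; lane `--supports stmt-HodgeConjecture-24832` (count-neutral helper).
THE POINT.  The Euler face of the #41 KIND-0 continuation letter wants the SPHERICAL Gindikin–Karpelevich value `∫_{N_Δ} Λ_s(w_Δ y) dν = c_v(s)` at the unramified
places.  On the cocycle road (★ B4d-3 `M_v = χ_s(m₀)·c_N·A₂A₁A₂`, ★ B7-M2s majorants) every rank-one stage of a right-`K₀`-invariant section is evaluated AT A POINT OF
LEVEL `0` by ★ (F-GK-1): `∫ f(w₀ u(x) y) dx = μ(𝒪)(1 + C₀(1−q⁻¹)(αq^{1−e})L(e−1,ν))·f(y)` — no normalised families, no regularity.  This file is the SPLIT-place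
twin (`E ⊗ F_v = E_{w₁} × E_{w₂}`, middle stage = the two short roots at `w₂` then `w₁`, chain ★ B7-CB §3 `hrel_short₂` ∕ ★ B7-CC `hrel_long_of_pair`) of K2E5-p16's
(F-GK-2); the proof is ★ B7s `normalisedRegularity_of_pair` with the three `exists_normalised_family` replaced by the EXPLICIT normalised stages `Nᵢ := L⁻¹·∫` and the
outermost∕point evaluations by ★ (F-GK-1).  The level-0 letters (`w₂`, `ℓ_{Aᵢ}`, `u(tδ^{±1})`, `u₋(1_{wᵢ}ζ)` in `K₀`) and the four `hrel` constants `C₀ᵢ` stay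
hypothesis-first ∕ symbolic; (F-GK-3) (K2Liu-p05 (g7)) discharges `hm₀ hC₁ hC₂ᵢ hC₃` at a good place and identifies `BOX` with `N_Δ ∩ H(𝒪_v)`.
HONEST LABEL.  `HC_CM` is proved only modulo the 7 printed citations (2 remaining named inputs: hLiu418 = `stmt-HodgeConjecture-24832`,
h413 = `stmt-HodgeConjecture-24833`) until rung 0 closes.

## References
* [Casselman1980] W. Casselman, *The unramified principal series of p-adic groups I*, Compositio Math. 40 (1980), §3 Thm. 3.1 (`T_w φ_K = c_w(χ) φ_K`).
* [KudlaSweet1997] S. Kudla, W. J. Sweet, Israel J. Math. 98 (1997), §1.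
* [HarrisKudlaSweet1996] M. Harris, S. Kudla, W. J. Sweet, J. AMS 9 (1996), §6 (6.14)–(6.16) (split places (6.16)).
-/

set_option autoImplicit false
set_option linter.dupNamespace false -- the mandated namespace repeats `HodgeConjecture.HodgeConjecture`

noncomputable section

open scoped Classical NNReal ENNReal
open NumberField IsDedekindDomain Matrix MeasureTheory Topology
open Literature.NumberTheory.GaloisRepresentations.IsNonarchimedeanLocalField
open Literature.NumberTheory.Automorphic Literature.NumberTheory.Automorphic.UnitaryGroup
open Literature.NumberTheory.GelbartRogawski1991.AdaptedBlocks
open Literature.NumberTheory.GelbartRogawski1991.UnitaryDualPair.LocalSplitting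
open Literature.NumberTheory.K2Lit.LocalSiegelDoubled
open Summit.HodgeConjecture.HodgeConjecture.Cruxes.HLiu418.K2LiuQRationalDefs Summit.HodgeConjecture.HodgeConjecture.Cruxes.HLiu418.K2LiuQRationalLFactor
open Summit.HodgeConjecture.HodgeConjecture.Cruxes.HLiu418.K2LiuLocalLFactorDefs Summit.HodgeConjecture.HodgeConjecture.Cruxes.HLiu418.K2LiuLocalSiegelIwasawaFrame
open Summit.HodgeConjecture.HodgeConjecture.Cruxes.HLiu418.K2LiuLocalSiegelIwasawa Summit.HodgeConjecture.HodgeConjecture.Cruxes.HLiu418.K2LiuDoubledUTwoTwoBorelFrame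
open Summit.HodgeConjecture.HodgeConjecture.Cruxes.HLiu418.K2LiuDoubledUTwoTwoWeylCocycle Summit.HodgeConjecture.HodgeConjecture.Cruxes.HLiu418.K2LiuDoubledUTwoTwoLevi
open Summit.HodgeConjecture.HodgeConjecture.Cruxes.HLiu418.K2LiuDoubledUTwoTwoFrameTransport Summit.HodgeConjecture.HodgeConjecture.Cruxes.HLiu418.K2LiuDoubledUTwoTwoUnipotentHaar
open Summit.HodgeConjecture.HodgeConjecture.Cruxes.HLiu418.K2LiuDoubledUTwoTwoLeviTransport Summit.HodgeConjecture.HodgeConjecture.Cruxes.HLiu418.K2LiuUnipDeltaRankOneCoordinates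
open Summit.HodgeConjecture.HodgeConjecture.Cruxes.HLiu418.K2LiuSiegelCocycleLetters Summit.HodgeConjecture.HodgeConjecture.Cruxes.HLiu418.K2LiuSiegelCocycleStageLetters
open Summit.HodgeConjecture.HodgeConjecture.Cruxes.HLiu418.K2LiuSiegelCocycleStageShort Summit.HodgeConjecture.HodgeConjecture.Cruxes.HLiu418.K2LiuSiegelCocycleChainShort
open Summit.HodgeConjecture.HodgeConjecture.Cruxes.HLiu418.K2LiuSiegelCocycleChainLong Summit.HodgeConjecture.HodgeConjecture.Cruxes.HLiu418.K2LiuSiegelIntertwiningCocycle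
open Summit.HodgeConjecture.HodgeConjecture.Cruxes.HLiu418.K2LiuRankOneStage Summit.HodgeConjecture.HodgeConjecture.Cruxes.HLiu418.K2LiuFlatSiegelFamilies
open Summit.HodgeConjecture.HodgeConjecture.Cruxes.HLiu418.K2LiuLocalRingPlaceDecomposition Summit.HodgeConjecture.HodgeConjecture.Cruxes.HLiu418.K2LiuA7NormalisedRegularitySetup
open Summit.HodgeConjecture.HodgeConjecture.Cruxes.HLiu418.K2LiuA7NormalisedRegularityMajorantSplit Summit.HodgeConjecture.HodgeConjecture.Cruxes.HLiu418.K2LiuA7NormaliserAlgebra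
open Summit.HodgeConjecture.HodgeConjecture.Cruxes.HLiu418.K2LiuA7NormalisedRegularitySplit Summit.HodgeConjecture.HodgeConjecture.Cruxes.HLiu418.K2LiuRankOneSphericalStage

namespace Summit.HodgeConjecture.HodgeConjecture.Cruxes.HLiu418.K2LiuSiegelCocycleSphericalValueSplit

variable (F : Type) [Field F] [NumberField F] (E : Type) [Field E] [NumberField E] [Algebra F E]
  [Algebra.IsQuadraticExtension F E] (c : E ≃ₐ[F] E)
  {δ : E} (hcδ : c δ = -δ) (hδ : δ ≠ 0) {d : F} (hd : δ * δ = algebraMap F E d) (v : HeightOneSpectrum (𝓞 F))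
  {T₂ : Matrix (Fin 2) (Fin 2) F} (hT₂ : T₂.IsSymm) {J₂D : Matrix (Fin (2 + 2)) (Fin (2 + 2)) E} (hJ₂D : J₂D = (gramD F 2 T₂).map (algebraMap F E))
  (D Dinv : Matrix (Fin 2) (Fin 2) F) (hDD : D * Dinv = 1) (hDD' : Dinv * D = 1) (Q : GL (Fin (2 + 2)) F)
  (hQm : (Q : Matrix (Fin (2 + 2)) (Fin (2 + 2)) F) = Matrix.reindex (e₂ 2) (e₂ 2) (Matrix.fromBlocks 1 D 1 (-D)))
  (hQ : (Q : Matrix (Fin (2 + 2)) (Fin (2 + 2)) F)ᵀ * gramD F 2 T₂ * (Q : Matrix (Fin (2 + 2)) (Fin (2 + 2)) F) = (StdForm.antidiagonal (2 + 2)).over F)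

section Box

variable [MeasurableSpace (v.adicCompletion F)] [BorelSpace (v.adicCompletion F)] [SecondCountableTopology (v.adicCompletion F)]
  [MeasurableSpace (UnitaryGroup.LocalRing E v)] [BorelSpace (UnitaryGroup.LocalRing E v)] [SecondCountableTopology (UnitaryGroup.LocalRing E v)]
  [MeasurableSpace (unipDeltaLocal F E c v 2 (JD := J₂D))] [BorelSpace (unipDeltaLocal F E c v 2 (JD := J₂D))]

/-- **`νN(BOX) = c_N · μ_F(𝒪) · (μ_{w₁}(𝒪_{w₁}) μ_{w₂}(𝒪_{w₂})) · μ_F(𝒪)` at a split place**: through the coordinates `e(b₁, z, b₂) = φ(n(ι_v(b₁)δ, z, ι_v(b₂)δ))`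
of `N_Δ(F_v)` (★ B1b-2b) and `e₂(ζ₁, ζ₂) = 1_{w₁} ζ₁ + 1_{w₂} ζ₂` of `E ⊗ F_v = E_{w₁} × E_{w₂}` (★ `exists_homeomorph_single_add_single`), the box
`BOX = e(𝒪 × e₂(𝒪_{w₁} × 𝒪_{w₂}) × 𝒪)` has `νN`-volume `c_N μ_F(𝒪) μ_{w₁}(𝒪_{w₁}) μ_{w₂}(𝒪_{w₂}) μ_F(𝒪)` when `νN = c_N · e_*(μ_F ⊗ (e₂)_*(μ_{w₁} ⊗ μ_{w₂}) ⊗ μ_F)`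
(★ B4d-3 `exists_measure_eq_smul_map`) — the split twin of ★ (F-GK-2) `measureReal_box_eq`. [cite: Weil1965, §37] -/
theorem measureReal_box_eq_of_pair
    (e : (v.adicCompletion F × UnitaryGroup.LocalRing E v × v.adicCompletion F) ≃ₜ unipDeltaLocal F E c v 2 (JD := J₂D))
    (he : ∀ b₁ z b₂, ((e (b₁, z, b₂) : unipDeltaLocal F E c v 2 (JD := J₂D)) : UnitaryGroup.localPi E c (2 + 2) J₂D v) = FrameTransport.frameConj F E c v (2 + 2) hJ₂D (antidiagonal_over_eq_map F E 2) Q hQ (toLocalFour F E c v (nSiegel (UnitaryGroup.LocalRing E v) (UnitaryGroup.conjLocal E c v) (UnitaryGroup.conjLocal_conjLocal c v hcδ hδ) (UnitaryGroup.toLocalRing E v b₁ * algebraMap E (UnitaryGroup.LocalRing E v) δ) z (UnitaryGroup.toLocalRing E v b₂ * algebraMap E (UnitaryGroup.LocalRing E v) δ) (conjLocal_coord F E c hcδ v b₁) (conjLocal_coord F E c hcδ v b₂))))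
    (νN : Measure (unipDeltaLocal F E c v 2 (JD := J₂D))) (μF : Measure (v.adicCompletion F)) [SFinite μF]
    (w₁ w₂ : PlacesOver E v) [MeasurableSpace (w₁.1.adicCompletion E)] [BorelSpace (w₁.1.adicCompletion E)] (μ₁ : Measure (w₁.1.adicCompletion E)) [SFinite μ₁]
    [MeasurableSpace (w₂.1.adicCompletion E)] [BorelSpace (w₂.1.adicCompletion E)] (μ₂ : Measure (w₂.1.adicCompletion E)) [SFinite μ₂]
    (e₂ : (w₁.1.adicCompletion E × w₂.1.adicCompletion E) ≃ₜ UnitaryGroup.LocalRing E v) (he₂ : ∀ ζ₁ ζ₂, e₂ (ζ₁, ζ₂) = Pi.single w₁ ζ₁ + Pi.single w₂ ζ₂)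
    (cN : ℝ≥0) (hν : νN = (cN : ℝ≥0∞) • Measure.map e.toMeasurableEquiv (μF.prod ((Measure.map (⇑e₂) (μ₁.prod μ₂)).prod μF))) :
    νN.real {u : unipDeltaLocal F E c v 2 (JD := J₂D) | ∃ b₁ ∈ primePowBall (v.adicCompletion F) 0, ∃ ζ₁ ∈ primePowBall (w₁.1.adicCompletion E) 0, ∃ ζ₂ ∈ primePowBall (w₂.1.adicCompletion E) 0, ∃ b₂ ∈ primePowBall (v.adicCompletion F) 0, (u : UnitaryGroup.localPi E c (2 + 2) J₂D v) = FrameTransport.frameConj F E c v (2 + 2) hJ₂D (antidiagonal_over_eq_map F E 2) Q hQ (toLocalFour F E c v (nSiegel (UnitaryGroup.LocalRing E v) (UnitaryGroup.conjLocal E c v) (UnitaryGroup.conjLocal_conjLocal c v hcδ hδ) (UnitaryGroup.toLocalRing E v b₁ * algebraMap E (UnitaryGroup.LocalRing E v) δ) (Pi.single w₁ ζ₁ + Pi.single w₂ ζ₂) (UnitaryGroup.toLocalRing E v b₂ * algebraMap E (UnitaryGroup.LocalRing E v) δ) (conjLocal_coord F E c hcδ v b₁) (conjLocal_coord F E c hcδ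 v b₂)))} =
      (cN : ℝ) * μF.real (primePowBall (v.adicCompletion F) 0) * (μ₁.real (primePowBall (w₁.1.adicCompletion E) 0) * μ₂.real (primePowBall (w₂.1.adicCompletion E) 0)) * μF.real (primePowBall (v.adicCompletion F) 0) := by
  haveI := secondCountableTopology_adicCompletion E w₁.1
  haveI := secondCountableTopology_adicCompletion E w₂.1
  -- the box in coordinates
  have hpre : e.toMeasurableEquiv ⁻¹' {u : unipDeltaLocal F E c v 2 (JD := J₂D) | ∃ b₁ ∈ primePowBall (v.adicCompletion F) 0, ∃ ζ₁ ∈ primePowBall (w₁.1.adicCompletion E) 0, ∃ ζ₂ ∈ primePowBall (w₂.1.adicCompletion E) 0, ∃ b₂ ∈ primePowBall (v.adicCompletion F) 0, (u : UnitaryGroup.localPi E c (2 + 2) J₂D v) = FrameTransport.frameConj F E c v (2 + 2) hJ₂D (antidiagonal_over_eq_map F E 2) Q hQ (toLocalFour F E c v (nSiegel (UnitaryGroup.LocalRing E v) (UnitaryGroup.conjLocal E c v) (UnitaryGroup.conjLocal_conjLocal c v hcδ hδ) (UnitaryGroup.toLocalRing E v b₁ * algebraMap E (UnitaryGroup.LocalRing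 E v) δ) (Pi.single w₁ ζ₁ + Pi.single w₂ ζ₂) (UnitaryGroup.toLocalRing E v b₂ * algebraMap E (UnitaryGroup.LocalRing E v) δ) (conjLocal_coord F E c hcδ v b₁) (conjLocal_coord F E c hcδ v b₂)))} =
      primePowBall (v.adicCompletion F) 0 ×ˢ ((⇑e₂ '' (primePowBall (w₁.1.adicCompletion E) 0 ×ˢ primePowBall (w₂.1.adicCompletion E) 0)) ×ˢ primePowBall (v.adicCompletion F) 0) := by
    ext ⟨b₁, z, b₂⟩
    simp only [Set.mem_preimage, Homeomorph.toMeasurableEquiv_coe, Set.mem_setOf_eq, Set.mem_prod, Set.mem_image, Prod.exists]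
    constructor
    · rintro ⟨b₁', hb₁', ζ₁, hζ₁, ζ₂, hζ₂, b₂', hb₂', hEq⟩
      rw [← he₂, ← he] at hEq
      have hinj := e.injective (Subtype.ext hEq)
      simp only [Prod.mk.injEq] at hinj
      obtain ⟨rfl, rfl, rfl⟩ := hinj
      exact ⟨hb₁', ⟨ζ₁, ζ₂, ⟨hζ₁, hζ₂⟩, rfl⟩, hb₂'⟩
    · rintro ⟨hb₁, ⟨ζ₁, ζ₂, ⟨hζ₁, hζ₂⟩, hz⟩, hb₂⟩
      exact ⟨b₁, hb₁, ζ₁, hζ₁, ζ₂, hζ₂, b₂, hb₂, by rw [← hz, he₂, he]⟩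
  have hmap : Measure.map (⇑e₂) (μ₁.prod μ₂) = Measure.map (⇑e₂.toMeasurableEquiv) (μ₁.prod μ₂) := by rw [Homeomorph.toMeasurableEquiv_coe]
  have himg : Measure.map (⇑e₂) (μ₁.prod μ₂) (⇑e₂ '' (primePowBall (w₁.1.adicCompletion E) 0 ×ˢ primePowBall (w₂.1.adicCompletion E) 0)) =
      μ₁ (primePowBall (w₁.1.adicCompletion E) 0) * μ₂ (primePowBall (w₂.1.adicCompletion E) 0) := by
    rw [hmap, MeasurableEquiv.map_apply, Homeomorph.toMeasurableEquiv_coe, e₂.injective.preimage_image, Measure.prod_prod]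
  simp only [measureReal_def]
  rw [hν, Measure.smul_apply, MeasurableEquiv.map_apply, hpre, Measure.prod_prod, Measure.prod_prod, himg, smul_eq_mul]
  simp only [ENNReal.toReal_mul, ENNReal.coe_toReal]
  ring

end Box

/-! ## §2 The raw value of the cocycle on a spherical section (split place) -/

/-- The cancellation of the three normalising `L`-factors along the four-stage tower (pure algebra). -/
theorem cancel_three {LA LB₁ LB₂ a b XC XB₁ XB₂ R : ℂ} (hA : LA ≠ 0) (hB₁ : LB₁ ≠ 0) (hB₂ : LB₂ ≠ 0) :
    a * (b * (LA * (LB₂ * (LB₁ * (XC * (LB₁⁻¹ * (XB₁ * (LB₂⁻¹ * (XB₂ * (LA⁻¹ * R)))))))))) = a * b * (XC * (XB₁ * (XB₂ * R))) := by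
  field_simp

set_option maxHeartbeats 400000 in -- MEASURED: > 200 000 (the four-stage tower + two Fubini exchanges, same scope as ★ B7s `normalisedRegularity_of_pair`), ≤ 400 000
include hcδ hδ hd hT₂ hDD hQm hQ in
/-- **THE SPHERICAL VALUE OF THE SIEGEL INTERTWINING COCYCLE AT A SPLIT PLACE (hypothesis-first in the level-0 letters).**  At a place `v` with two places
`w₁ ≠ w₂` of `E` above it, for a unitary `χ_v`, a Siegel section `f₀ ∈ I_v(s, χ_v)` (`1 < re s`) right-invariant under an open subgroup `K₀` containing the cocycle's
level-0 letters — the frame images of `w₂`, of the Levi elements `ℓ_{A₁}`, `ℓ_{A₂}`, of `u(t δ)`, `u(t δ⁻¹)` (`t ∈ 𝒪_{F_v}`) and of `u₋(1_{wᵢ} ζ)` (`ζ ∈ 𝒪_{E_{wᵢ}}`) — and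
`h ∈ K₀`: the local intertwining integral is the product of the FOUR spherical rank-one values (★ (F-GK-1) `integrable_and_integral_eq_of_level_zero`, stages
`A` (`L_F(2s+1)`), `B_{w₂}`, `B_{w₁}` (`L_{E_{wᵢ}}(2s)`), `C` (`L_F(2s−1)`), chained by ★ B4d-3 + ★ B7-M2s exactly as ★ B7s `normalisedRegularity_of_pair`) times `f₀(1)`:
`M_v(s) f₀ (h) = χ_s(m₀) · c_N · Π_{i ∈ {C, B₁, B₂, A}} μᵢ(𝒪) (1 + C₀ᵢ (1 − qᵢ⁻¹) (αᵢ qᵢ^{1−eᵢ}) L(eᵢ − 1, νᵢ)) · f₀(1)` — the `C₀ᵢ` are the cocycle's `hrel` constants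
(★ B4d-1b ∕ B7-CB ∕ B7-CC), pinned to `1` at a good place in the sequel (F-GK-3). [cite: Casselman1980, §3 Thm. 3.1] [cite: KudlaSweet1997, §1] [cite: HarrisKudlaSweet1996, §6 (6.16)] -/
theorem localIntertwining_eq_of_spherical_of_pair_coord
    [MeasurableSpace (unipDeltaLocal F E c v 2 (JD := J₂D))] [BorelSpace (unipDeltaLocal F E c v 2 (JD := J₂D))]
    (νN : Measure (unipDeltaLocal F E c v 2 (JD := J₂D))) [νN.IsHaarMeasure]
    (χv : ∀ w : PlacesOver E v, (w.1.adicCompletion E)ˣ →* ℂˣ) (hχ : ∀ (w' : PlacesOver E v) (x : (w'.1.adicCompletion E)ˣ), ‖((χv w' x : ℂˣ) : ℂ)‖ = 1)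
    {s : ℂ} (hs : 1 < s.re) (f₀ : UnitaryGroup.localPi E c (2 + 2) J₂D v → ℂ) (hf₀ : IsLocalSiegelSection F E c hcδ hδ hd v 2 hT₂ hJ₂D χv s f₀) (hsm₀ : IsSmooth F E c v 2 f₀)
    (K₀ : OpenSubgroup (UnitaryGroup.localPi E c (2 + 2) J₂D v)) (hfK : ∀ g, ∀ k ∈ (K₀ : Subgroup (UnitaryGroup.localPi E c (2 + 2) J₂D v)), f₀ (g * k) = f₀ g)
    (w₁ w₂ : PlacesOver E v) (hne : w₁ ≠ w₂) (hw : ∀ w' : PlacesOver E v, w' = w₁ ∨ w' = w₂)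
    [MeasurableSpace (v.adicCompletion F)] [BorelSpace (v.adicCompletion F)] (μF : Measure (v.adicCompletion F)) [μF.IsAddHaarMeasure]
    [MeasurableSpace (w₁.1.adicCompletion E)] [BorelSpace (w₁.1.adicCompletion E)] (μ₁ : Measure (w₁.1.adicCompletion E)) [μ₁.IsAddHaarMeasure]
    [MeasurableSpace (w₂.1.adicCompletion E)] [BorelSpace (w₂.1.adicCompletion E)] (μ₂ : Measure (w₂.1.adicCompletion E)) [μ₂.IsAddHaarMeasure]
    [MeasurableSpace (UnitaryGroup.LocalRing E v)] [BorelSpace (UnitaryGroup.LocalRing E v)]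
    (e₂ : (w₁.1.adicCompletion E × w₂.1.adicCompletion E) ≃ₜ UnitaryGroup.LocalRing E v) (he₂ : ∀ ζ₁ ζ₂, e₂ (ζ₁, ζ₂) = Pi.single w₁ ζ₁ + Pi.single w₂ ζ₂)
    (A₁ : GL (Fin 2) (UnitaryGroup.LocalRing E v)) (hA₁ : A₁.val = !![1 - Pi.single w₁ 1, Pi.single w₁ 1; Pi.single w₁ 1, 1 - Pi.single w₁ 1])
    (A₂ : GL (Fin 2) (UnitaryGroup.LocalRing E v)) (hA₂ : A₂.val = !![1 - Pi.single w₂ 1, Pi.single w₂ 1; Pi.single w₂ 1, 1 - Pi.single w₂ 1])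
    (e3 : (v.adicCompletion F × UnitaryGroup.LocalRing E v × v.adicCompletion F) ≃ₜ unipDeltaLocal F E c v 2 (JD := J₂D))
    (he3 : ∀ b₁ z b₂, ((e3 (b₁, z, b₂) : unipDeltaLocal F E c v 2 (JD := J₂D)) : UnitaryGroup.localPi E c (2 + 2) J₂D v) =
      FrameTransport.frameConj F E c v (2 + 2) hJ₂D (antidiagonal_over_eq_map F E 2) Q hQ (toLocalFour F E c v (nSiegel (UnitaryGroup.LocalRing E v) (UnitaryGroup.conjLocal E c v) (UnitaryGroup.conjLocal_conjLocal c v hcδ hδ)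
        (UnitaryGroup.toLocalRing E v b₁ * algebraMap E (UnitaryGroup.LocalRing E v) δ) z (UnitaryGroup.toLocalRing E v b₂ * algebraMap E (UnitaryGroup.LocalRing E v) δ) (conjLocal_coord F E c hcδ v b₁) (conjLocal_coord F E c hcδ v b₂))))
    (cN : ℝ≥0) (hν : νN = (cN : ℝ≥0∞) • Measure.map (⇑e3) (μF.prod ((Measure.map (⇑e₂) (μ₁.prod μ₂)).prod μF)))
    -- the level-0 letters inside `K₀`
    (hKw₂ : FrameTransport.frameConj F E c v (2 + 2) hJ₂D (antidiagonal_over_eq_map F E 2) Q hQ (toLocalFour F E c v (weylTwo (UnitaryGroup.LocalRing E v) (UnitaryGroup.conjLocal E c v))) ∈ (K₀ : Subgroup (UnitaryGroup.localPi E c (2 + 2) J₂D v)))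
    (hKA₁ : FrameTransport.frameConj F E c v (2 + 2) hJ₂D (antidiagonal_over_eq_map F E 2) Q hQ (toLocalFour F E c v (leviElt (UnitaryGroup.LocalRing E v) (UnitaryGroup.conjLocal E c v) (UnitaryGroup.conjLocal_conjLocal c v hcδ hδ) A₁)) ∈ (K₀ : Subgroup (UnitaryGroup.localPi E c (2 + 2) J₂D v))) (hKA₂ : FrameTransport.frameConj F E c v (2 + 2) hJ₂D (antidiagonal_over_eq_map F E 2) Q hQ (toLocalFour F E c v (leviElt (UnitaryGroup.LocalRing E v) (UnitaryGroup.conjLocal E c v) (UnitaryGroup.conjLocal_conjLocal c v hcδ hδ) A₂)) ∈ (K₀ : Subgroup (UnitaryGroup.localPi E c (2 + 2) J₂D v)))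
    (hKu : ∀ t ∈ primePowBall (v.adicCompletion F) 0, FrameTransport.frameConj F E c v (2 + 2) hJ₂D (antidiagonal_over_eq_map F E 2) Q hQ (toLocalFour F E c v (uLongTwo (UnitaryGroup.LocalRing E v) (UnitaryGroup.conjLocal E c v) (UnitaryGroup.toLocalRing E v t * algebraMap E (UnitaryGroup.LocalRing E v) δ) (conjLocal_coord F E c hcδ v t))) ∈ (K₀ : Subgroup (UnitaryGroup.localPi E c (2 + 2) J₂D v)))
    (hKū : ∀ t ∈ primePowBall (v.adicCompletion F) 0, FrameTransport.frameConj F E c v (2 + 2) hJ₂D (antidiagonal_over_eq_map F E 2) Q hQ (toLocalFour F E c v (uLongTwo (UnitaryGroup.LocalRing E v) (UnitaryGroup.conjLocal E c v) (UnitaryGroup.toLocalRing E v t * algebraMap E (UnitaryGroup.LocalRing E v) δ⁻¹) (conjLocal_coord_inv F E c hcδ v t))) ∈ (K₀ : Subgroup (UnitaryGroup.localPi E c (2 + 2) J₂D v)))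
    (hKm₁ : ∀ ζ ∈ primePowBall (w₁.1.adicCompletion E) 0, FrameTransport.frameConj F E c v (2 + 2) hJ₂D (antidiagonal_over_eq_map F E 2) Q hQ (toLocalFour F E c v (uMinus (UnitaryGroup.LocalRing E v) (UnitaryGroup.conjLocal E c v) (UnitaryGroup.conjLocal_conjLocal c v hcδ hδ) (Pi.single w₁ ζ))) ∈ (K₀ : Subgroup (UnitaryGroup.localPi E c (2 + 2) J₂D v)))
    (hKm₂ : ∀ ζ ∈ primePowBall (w₂.1.adicCompletion E) 0, FrameTransport.frameConj F E c v (2 + 2) hJ₂D (antidiagonal_over_eq_map F E 2) Q hQ (toLocalFour F E c v (uMinus (UnitaryGroup.LocalRing E v) (UnitaryGroup.conjLocal E c v) (UnitaryGroup.conjLocal_conjLocal c v hcδ hδ) (Pi.single w₂ ζ))) ∈ (K₀ : Subgroup (UnitaryGroup.localPi E c (2 + 2) J₂D v)))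
    (h : UnitaryGroup.localPi E c (2 + 2) J₂D v) (hh : h ∈ (K₀ : Subgroup (UnitaryGroup.localPi E c (2 + 2) J₂D v))) :
    localIntertwining F E c v 2 hJ₂D νN f₀ h =
      localSiegelCharacter F E c v 2 χv s (weylDelta F E c v 2 hJ₂D (T₀ := T₂) * FrameTransport.frameConj F E c v (2 + 2) hJ₂D (antidiagonal_over_eq_map F E 2) Q hQ (toLocalFour F E c v (weylSiegel (UnitaryGroup.LocalRing E v) (UnitaryGroup.conjLocal E c v)))) * ((cN : ℝ) : ℂ) *
        (((μF.real (primePowBall (v.adicCompletion F) 0) : ℂ) * (1 + (localSiegelCharacter F E c v 2 χv s (FrameTransport.frameConj F E c v (2 + 2) hJ₂D (antidiagonal_over_eq_map F E 2) Q hQ (toLocalFour F E c v (torusElt (UnitaryGroup.LocalRing E v) (UnitaryGroup.conjLocal E c v) (UnitaryGroup.conjLocal_conjLocal c v hcδ hδ) (-((Units.mk0 δ hδ).map (algebraMap E (UnitaryGroup.LocalRing E v) : E →* UnitaryGroup.LocalRing E v))⁻¹) 1))) * ((∏ w' : PlacesOver E v, ‖algebraMap E (UnitaryGroup.LocalRing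 E v) δ w'‖ : ℝ) : ℂ)) * (1 - (residueFieldCard (v.adicCompletion F) : ℂ)⁻¹) * (unramValue F v (chiF F E v χv) * (residueFieldCard (v.adicCompletion F) : ℂ) ^ (1 - (((2 : ℕ) : ℂ) * s + 0))) * lFactor F v (chiF F E v χv) (((2 : ℕ) : ℂ) * s + 0 - 1))) *
        (((μ₁.real (primePowBall (w₁.1.adicCompletion E) 0) : ℂ) * (1 + ((χv w₁ (-1) : ℂˣ) : ℂ) * (1 - (residueFieldCard (w₁.1.adicCompletion E) : ℂ)⁻¹) * (unramValue E w₁.1 (chiNorm F E c v χv w₁) * (residueFieldCard (w₁.1.adicCompletion E) : ℂ) ^ (1 - (((2 : ℕ) : ℂ) * s + 1))) * lFactor E w₁.1 (chiNorm F E c v χv w₁) (((2 : ℕ) : ℂ) * s + 1 - 1))) *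
        (((μ₂.real (primePowBall (w₂.1.adicCompletion E) 0) : ℂ) * (1 + ((χv w₂ (-1) : ℂˣ) : ℂ) * (1 - (residueFieldCard (w₂.1.adicCompletion E) : ℂ)⁻¹) * (unramValue E w₂.1 (chiNorm F E c v χv w₂) * (residueFieldCard (w₂.1.adicCompletion E) : ℂ) ^ (1 - (((2 : ℕ) : ℂ) * s + 1))) * lFactor E w₂.1 (chiNorm F E c v χv w₂) (((2 : ℕ) : ℂ) * s + 1 - 1))) *
        (((μF.real (primePowBall (v.adicCompletion F) 0) : ℂ) * (1 + localSiegelCharacter F E c v 2 χv s (FrameTransport.frameConj F E c v (2 + 2) hJ₂D (antidiagonal_over_eq_map F E 2) Q hQ (toLocalFour F E c v (torusElt (UnitaryGroup.LocalRing E v) (UnitaryGroup.conjLocal E c v) (UnitaryGroup.conjLocal_conjLocal c v hcδ hδ) 1 (-((Units.mk0 δ hδ).map (algebraMap E (UnitaryGroup.LocalRing E v) : E →* UnitaryGroup.LocalRing E v))⁻¹)))) * (1 - (residueFieldCard (v.adicCompletion F) : ℂ)⁻¹) * (unramValue F v (chiF F E v χv) * (residueFieldCard (v.adicCompletion F) :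 ℂ) ^ (1 - (((2 : ℕ) : ℂ) * s + 2))) * lFactor F v (chiF F E v χv) (((2 : ℕ) : ℂ) * s + 2 - 1))) * f₀ 1)))) := by
  -- topology and measures on `F_v`, `E_{w₁}`, `E_{w₂}`, `E ⊗ F_v`
  haveI := secondCountableTopology_adicCompletion F v
  haveI : ∀ w' : PlacesOver E v, SecondCountableTopology (w'.1.adicCompletion E) := fun w' => secondCountableTopology_adicCompletion E w'.1
  haveI hμ12 : (μ₁.prod μ₂).IsAddHaarMeasure := Measure.prod.instIsAddHaarMeasure μ₁ μ₂
  have hmapR : Measure.map (⇑e₂) (μ₁.prod μ₂) = Measure.map (⇑e₂.toMeasurableEquiv) (μ₁.prod μ₂) := by rw [Homeomorph.toMeasurableEquiv_coe]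
  have hμRint : ∀ G : UnitaryGroup.LocalRing E v → ℂ, ∫ z, G z ∂(Measure.map (⇑e₂) (μ₁.prod μ₂)) = ∫ p, G (Pi.single w₁ p.1 + Pi.single w₂ p.2) ∂(μ₁.prod μ₂) := fun G => by
    rw [hmapR, integral_map_equiv]; exact integral_congr_ae (Filter.Eventually.of_forall fun p => by rw [Homeomorph.toMeasurableEquiv_coe]; exact congrArg G (he₂ p.1 p.2))
  have huB1 := continuous_frameConj_uMinus_single F E c hcδ hδ v hJ₂D Q hQ w₁ e3 he3
  have huB2 := continuous_frameConj_uMinus_single F E c hcδ hδ v hJ₂D Q hQ w₂ e3 he3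
  have huB1add : ∀ ζ ζ' : w₁.1.adicCompletion E, FrameTransport.frameConj F E c v (2 + 2) hJ₂D (antidiagonal_over_eq_map F E 2) Q hQ (toLocalFour F E c v (uMinus (UnitaryGroup.LocalRing E v) (UnitaryGroup.conjLocal E c v) (UnitaryGroup.conjLocal_conjLocal c v hcδ hδ) (Pi.single w₁ (ζ + ζ')))) = FrameTransport.frameConj F E c v (2 + 2) hJ₂D (antidiagonal_over_eq_map F E 2) Q hQ (toLocalFour F E c v (uMinus (UnitaryGroup.LocalRing E v) (UnitaryGroup.conjLocal E c v) (UnitaryGroup.conjLocal_conjLocal c v hcδ hδ) (Pi.single w₁ ζ))) * FrameTransport.frameConj F E c v (2 + 2) hJ₂D (antidiagonal_over_eq_map F E 2) Q hQ (toLocalFour F E c v (uMinus (UnitaryGroup.LocalRing E v) (UnitaryGroup.conjLocal E c v) (UnitaryGroup.conjLocal_conjLocal c v hcδ hδ) (Pi.single w₁ ζ'))) := fun ζ ζ' => by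
      rw [show uMinus (UnitaryGroup.LocalRing E v) (UnitaryGroup.conjLocal E c v) (UnitaryGroup.conjLocal_conjLocal c v hcδ hδ) (Pi.single w₁ (ζ + ζ')) =
          uMinus (UnitaryGroup.LocalRing E v) (UnitaryGroup.conjLocal E c v) (UnitaryGroup.conjLocal_conjLocal c v hcδ hδ) (Pi.single w₁ ζ) * uMinus (UnitaryGroup.LocalRing E v) (UnitaryGroup.conjLocal E c v) (UnitaryGroup.conjLocal_conjLocal c v hcδ hδ) (Pi.single w₁ ζ') by
        rw [uMinus_mul, ← Pi.single_add], map_mul, map_mul]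
  have huB2add : ∀ ζ ζ' : w₂.1.adicCompletion E, FrameTransport.frameConj F E c v (2 + 2) hJ₂D (antidiagonal_over_eq_map F E 2) Q hQ (toLocalFour F E c v (uMinus (UnitaryGroup.LocalRing E v) (UnitaryGroup.conjLocal E c v) (UnitaryGroup.conjLocal_conjLocal c v hcδ hδ) (Pi.single w₂ (ζ + ζ')))) = FrameTransport.frameConj F E c v (2 + 2) hJ₂D (antidiagonal_over_eq_map F E 2) Q hQ (toLocalFour F E c v (uMinus (UnitaryGroup.LocalRing E v) (UnitaryGroup.conjLocal E c v) (UnitaryGroup.conjLocal_conjLocal c v hcδ hδ) (Pi.single w₂ ζ))) * FrameTransport.frameConj F E c v (2 + 2) hJ₂D (antidiagonal_over_eq_map F E 2) Q hQ (toLocalFour F E c v (uMinus (UnitaryGroup.LocalRing E v) (UnitaryGroup.conjLocal E c v) (UnitaryGroup.conjLocal_conjLocal c v hcδ hδ) (Pi.single w₂ ζ'))) := fun ζ ζ' => by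
      rw [show uMinus (UnitaryGroup.LocalRing E v) (UnitaryGroup.conjLocal E c v) (UnitaryGroup.conjLocal_conjLocal c v hcδ hδ) (Pi.single w₂ (ζ + ζ')) =
          uMinus (UnitaryGroup.LocalRing E v) (UnitaryGroup.conjLocal E c v) (UnitaryGroup.conjLocal_conjLocal c v hcδ hδ) (Pi.single w₂ ζ) * uMinus (UnitaryGroup.LocalRing E v) (UnitaryGroup.conjLocal E c v) (UnitaryGroup.conjLocal_conjLocal c v hcδ hδ) (Pi.single w₂ ζ') by
        rw [uMinus_mul, ← Pi.single_add], map_mul, map_mul]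
  -- the middle word through the two places (second place innermost, ★ B7-M1)
  have hw' : ∀ w' : PlacesOver E v, w' = w₂ ∨ w' = w₁ := fun w' => (hw w').symm
  have hmid : ∀ (ζ₁ : w₁.1.adicCompletion E) (ζ₂ : w₂.1.adicCompletion E) (g : UnitaryGroup.localPi E c (2 + 2) J₂D v),
      FrameTransport.frameConj F E c v (2 + 2) hJ₂D (antidiagonal_over_eq_map F E 2) Q hQ (toLocalFour F E c v (weylOne (UnitaryGroup.LocalRing E v) (UnitaryGroup.conjLocal E c v))) * FrameTransport.frameConj F E c v (2 + 2) hJ₂D (antidiagonal_over_eq_map F E 2) Q hQ (toLocalFour F E c v (uMinus (UnitaryGroup.LocalRing E v) (UnitaryGroup.conjLocal E c v) (UnitaryGroup.conjLocal_conjLocal c v hcδ hδ) (Pi.single w₁ ζ₁ + Pi.single w₂ ζ₂))) * g =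
        FrameTransport.frameConj F E c v (2 + 2) hJ₂D (antidiagonal_over_eq_map F E 2) Q hQ (toLocalFour F E c v (leviElt (UnitaryGroup.LocalRing E v) (UnitaryGroup.conjLocal E c v) (UnitaryGroup.conjLocal_conjLocal c v hcδ hδ) A₂)) * FrameTransport.frameConj F E c v (2 + 2) hJ₂D (antidiagonal_over_eq_map F E 2) Q hQ (toLocalFour F E c v (uMinus (UnitaryGroup.LocalRing E v) (UnitaryGroup.conjLocal E c v) (UnitaryGroup.conjLocal_conjLocal c v hcδ hδ) (Pi.single w₂ ζ₂))) * (FrameTransport.frameConj F E c v (2 + 2) hJ₂D (antidiagonal_over_eq_map F E 2) Q hQ (toLocalFour F E c v (leviElt (UnitaryGroup.LocalRing E v) (UnitaryGroup.conjLocal E c v) (UnitaryGroup.conjLocal_conjLocal c v hcδ hδ) A₁)) * FrameTransport.frameConj F E c v (2 + 2) hJ₂D (antidiagonal_over_eq_map F E 2) Q hQ (toLocalFour F E c v (uMinus (UnitaryGroup.LocalRing E v) (UnitaryGroup.conjLocal E c v) (UnitaryGroup.conjLocal_conjLocal c v hcδ hδ) (Pi.single w₁ ζ₁))) * g) := by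
    intro ζ₁ ζ₂ g; rw [frameConj_weylOne_mul_uMinus_of_pair F E c hcδ hδ v hJ₂D Q hQ (Ne.symm hne) hw' A₂ A₁ hA₂ hA₁]
    simp only [Pi.add_apply, Pi.single_eq_same, Pi.single_eq_of_ne hne, Pi.single_eq_of_ne (Ne.symm hne), add_zero, zero_add]
  have heA : 1 < (((2 : ℕ) : ℂ) * s + 2).re := by simp; linarith
  -- STAGE A: the explicit normalised stage `N₁ := L_F(2s+1)⁻¹ · ∫ f₀(φ(w₂) u(yδ) ·) dy`
  obtain ⟨N₁, hN₁eq⟩ : ∃ N₁ : UnitaryGroup.localPi E c (2 + 2) J₂D v → ℂ, ∀ g, N₁ g = (lFactor F v (chiF F E v χv) (((2 : ℕ) : ℂ) * s + 2 - 1))⁻¹ *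
      ∫ y, f₀ (FrameTransport.frameConj F E c v (2 + 2) hJ₂D (antidiagonal_over_eq_map F E 2) Q hQ (toLocalFour F E c v (weylTwo (UnitaryGroup.LocalRing E v) (UnitaryGroup.conjLocal E c v))) * FrameTransport.frameConj F E c v (2 + 2) hJ₂D (antidiagonal_over_eq_map F E 2) Q hQ (toLocalFour F E c v (uLongTwo (UnitaryGroup.LocalRing E v) (UnitaryGroup.conjLocal E c v) (UnitaryGroup.toLocalRing E v y * algebraMap E (UnitaryGroup.LocalRing E v) δ) (conjLocal_coord F E c hcδ v y))) * g) ∂μF := ⟨_, fun g => rfl⟩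
  have hLA : lFactor F v (chiF F E v χv) (((2 : ℕ) : ℂ) * s + 2 - 1) ≠ 0 := lFactor_ne_zero (norm_unramValue_le_one (norm_chiF_eq_one (F := F) (E := E) hχ)) (by simp; linarith)
  have hN₁ : ∀ g, ∫ y, f₀ (FrameTransport.frameConj F E c v (2 + 2) hJ₂D (antidiagonal_over_eq_map F E 2) Q hQ (toLocalFour F E c v (weylTwo (UnitaryGroup.LocalRing E v) (UnitaryGroup.conjLocal E c v))) * FrameTransport.frameConj F E c v (2 + 2) hJ₂D (antidiagonal_over_eq_map F E 2) Q hQ (toLocalFour F E c v (uLongTwo (UnitaryGroup.LocalRing E v) (UnitaryGroup.conjLocal E c v) (UnitaryGroup.toLocalRing E v y * algebraMap E (UnitaryGroup.LocalRing E v) δ) (conjLocal_coord F E c hcδ v y))) * g) ∂μF = lFactor F v (chiF F E v χv) (((2 : ℕ) : ℂ) * s + 2 - 1) * N₁ g := fun g => by rw [hN₁eq, ← mul_assoc, mul_inv_cancel₀ (hLA), one_mul]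
  have hN₁K : ∀ g, ∀ k ∈ (K₀ : Subgroup (UnitaryGroup.localPi E c (2 + 2) J₂D v)), N₁ (g * k) = N₁ g := fun g k hk => by
    rw [hN₁eq, hN₁eq]; exact congrArg _ (integral_congr_ae (Filter.Eventually.of_forall fun y => by simp only [← mul_assoc]; exact hfK _ k hk))
  -- STAGE B at `w₂`: `N₁ ↦ N₂'`, numerator `L_{E_{w₂}}(2s, χ_F ∘ N)`
  have heB : 1 < (((2 : ℕ) : ℂ) * s + 1).re := by simp; linarith
  obtain ⟨N₂', hN₂'eq⟩ : ∃ N₂' : UnitaryGroup.localPi E c (2 + 2) J₂D v → ℂ, ∀ g, N₂' g = (lFactor E w₂.1 (chiNorm F E c v χv w₂) (((2 : ℕ) : ℂ) * s + 1 - 1))⁻¹ *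
      ∫ ζ, N₁ (FrameTransport.frameConj F E c v (2 + 2) hJ₂D (antidiagonal_over_eq_map F E 2) Q hQ (toLocalFour F E c v (leviElt (UnitaryGroup.LocalRing E v) (UnitaryGroup.conjLocal E c v) (UnitaryGroup.conjLocal_conjLocal c v hcδ hδ) A₂)) * FrameTransport.frameConj F E c v (2 + 2) hJ₂D (antidiagonal_over_eq_map F E 2) Q hQ (toLocalFour F E c v (uMinus (UnitaryGroup.LocalRing E v) (UnitaryGroup.conjLocal E c v) (UnitaryGroup.conjLocal_conjLocal c v hcδ hδ) (Pi.single w₂ ζ))) * g) ∂μ₂ := ⟨_, fun g => rfl⟩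
  have hLB₂ : lFactor E w₂.1 (chiNorm F E c v χv w₂) (((2 : ℕ) : ℂ) * s + 1 - 1) ≠ 0 := lFactor_ne_zero (norm_unramValue_le_one (norm_chiNorm_eq_one (F := F) (E := E) (c := c) hχ w₂)) (by simp; linarith)
  have hN₂' : ∀ g, ∫ ζ, N₁ (FrameTransport.frameConj F E c v (2 + 2) hJ₂D (antidiagonal_over_eq_map F E 2) Q hQ (toLocalFour F E c v (leviElt (UnitaryGroup.LocalRing E v) (UnitaryGroup.conjLocal E c v) (UnitaryGroup.conjLocal_conjLocal c v hcδ hδ) A₂)) * FrameTransport.frameConj F E c v (2 + 2) hJ₂D (antidiagonal_over_eq_map F E 2) Q hQ (toLocalFour F E c v (uMinus (UnitaryGroup.LocalRing E v) (UnitaryGroup.conjLocal E c v) (UnitaryGroup.conjLocal_conjLocal c v hcδ hδ) (Pi.single w₂ ζ))) * g) ∂μ₂ = lFactor E w₂.1 (chiNorm F E c v χv w₂) (((2 : ℕ) : ℂ) * s + 1 - 1) * N₂' g := fun g => by rw [hN₂'eq, ← mul_assoc, mul_inv_cancel₀ hLB₂, one_mul]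
  have hN₂'K : ∀ g, ∀ k ∈ (K₀ : Subgroup (UnitaryGroup.localPi E c (2 + 2) J₂D v)), N₂' (g * k) = N₂' g := fun g k hk => by
    rw [hN₂'eq, hN₂'eq]; exact congrArg _ (integral_congr_ae (Filter.Eventually.of_forall fun ζ => by simp only [← mul_assoc]; exact hN₁K _ k hk))
  -- STAGE B at `w₁`: `N₂' ↦ N₂`, numerator `L_{E_{w₁}}(2s, χ_F ∘ N)` (★ B7-CB §3 `hrel_short₂`)
  obtain ⟨N₂, hN₂eq⟩ : ∃ N₂ : UnitaryGroup.localPi E c (2 + 2) J₂D v → ℂ, ∀ g, N₂ g = (lFactor E w₁.1 (chiNorm F E c v χv w₁) (((2 : ℕ) : ℂ) * s + 1 - 1))⁻¹ *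
      ∫ ζ, N₂' (FrameTransport.frameConj F E c v (2 + 2) hJ₂D (antidiagonal_over_eq_map F E 2) Q hQ (toLocalFour F E c v (leviElt (UnitaryGroup.LocalRing E v) (UnitaryGroup.conjLocal E c v) (UnitaryGroup.conjLocal_conjLocal c v hcδ hδ) A₁)) * FrameTransport.frameConj F E c v (2 + 2) hJ₂D (antidiagonal_over_eq_map F E 2) Q hQ (toLocalFour F E c v (uMinus (UnitaryGroup.LocalRing E v) (UnitaryGroup.conjLocal E c v) (UnitaryGroup.conjLocal_conjLocal c v hcδ hδ) (Pi.single w₁ ζ))) * g) ∂μ₁ := ⟨_, fun g => rfl⟩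
  have hLB₁ : lFactor E w₁.1 (chiNorm F E c v χv w₁) (((2 : ℕ) : ℂ) * s + 1 - 1) ≠ 0 := lFactor_ne_zero (norm_unramValue_le_one (norm_chiNorm_eq_one (F := F) (E := E) (c := c) hχ w₁)) (by simp; linarith)
  have hN₂ : ∀ g, ∫ ζ, N₂' (FrameTransport.frameConj F E c v (2 + 2) hJ₂D (antidiagonal_over_eq_map F E 2) Q hQ (toLocalFour F E c v (leviElt (UnitaryGroup.LocalRing E v) (UnitaryGroup.conjLocal E c v) (UnitaryGroup.conjLocal_conjLocal c v hcδ hδ) A₁)) * FrameTransport.frameConj F E c v (2 + 2) hJ₂D (antidiagonal_over_eq_map F E 2) Q hQ (toLocalFour F E c v (uMinus (UnitaryGroup.LocalRing E v) (UnitaryGroup.conjLocal E c v) (UnitaryGroup.conjLocal_conjLocal c v hcδ hδ) (Pi.single w₁ ζ))) * g) ∂μ₁ = lFactor E w₁.1 (chiNorm F E c v χv w₁) (((2 : ℕ) : ℂ) * s + 1 - 1) * N₂ g := fun g => by rw [hN₂eq, ← mul_assoc, mul_inv_cancel₀ hLB₁, one_mul]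
  have hN₂K : ∀ g, ∀ k ∈ (K₀ : Subgroup (UnitaryGroup.localPi E c (2 + 2) J₂D v)), N₂ (g * k) = N₂ g := fun g k hk => by
    rw [hN₂eq, hN₂eq]; exact congrArg _ (integral_congr_ae (Filter.Eventually.of_forall fun ζ => by simp only [← mul_assoc]; exact hN₂'K _ k hk))
  have heC : 1 < (((2 : ℕ) : ℂ) * s + 0).re := by simp; linarith
  -- STAGE C, evaluated at the level-0 point `h ∈ K₀` (★ (F-GK-1))
  have hC := integrable_and_integral_eq_of_level_zero μF hN₂K (u := fun y => FrameTransport.frameConj F E c v (2 + 2) hJ₂D (antidiagonal_over_eq_map F E 2) Q hQ (toLocalFour F E c v (uLongTwo (UnitaryGroup.LocalRing E v) (UnitaryGroup.conjLocal E c v) (UnitaryGroup.toLocalRing E v y * algebraMap E (UnitaryGroup.LocalRing E v) δ) (conjLocal_coord F E c hcδ v y)))) (ū := fun t => FrameTransport.frameConj F E c v (2 + 2) hJ₂D (antidiagonal_over_eq_map F E 2) Q hQ (toLocalFour F E c v (weylTwo (UnitaryGroup.LocalRing E v) (UnitaryGroup.conjLocal E c v))) * FrameTransport.frameConj F E c v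 (2 + 2) hJ₂D (antidiagonal_over_eq_map F E 2) Q hQ (toLocalFour F E c v (uLongTwo (UnitaryGroup.LocalRing E v) (UnitaryGroup.conjLocal E c v) (UnitaryGroup.toLocalRing E v t * algebraMap E (UnitaryGroup.LocalRing E v) δ⁻¹) (conjLocal_coord_inv F E c hcδ v t))) * FrameTransport.frameConj F E c v (2 + 2) hJ₂D (antidiagonal_over_eq_map F E 2) Q hQ (toLocalFour F E c v (weylTwo (UnitaryGroup.LocalRing E v) (UnitaryGroup.conjLocal E c v))))
    (frameConj_uLongTwo_coord_add F E c hcδ v hJ₂D Q hQ) (FrameTransport.frameConj F E c v (2 + 2) hJ₂D (antidiagonal_over_eq_map F E 2) Q hQ (toLocalFour F E c v (weylTwo (UnitaryGroup.LocalRing E v) (UnitaryGroup.conjLocal E c v)))) (chiF F E v χv) (norm_chiF_eq_one (F := F) (E := E) hχ) (((2 : ℕ) : ℂ) * s + 0)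
    (localSiegelCharacter F E c v 2 χv s (FrameTransport.frameConj F E c v (2 + 2) hJ₂D (antidiagonal_over_eq_map F E 2) Q hQ (toLocalFour F E c v (torusElt (UnitaryGroup.LocalRing E v) (UnitaryGroup.conjLocal E c v) (UnitaryGroup.conjLocal_conjLocal c v hcδ hδ) (-((Units.mk0 δ hδ).map (algebraMap E (UnitaryGroup.LocalRing E v) : E →* UnitaryGroup.LocalRing E v))⁻¹) 1))) * ((∏ w' : PlacesOver E v, ‖algebraMap E (UnitaryGroup.LocalRing E v) δ w'‖ : ℝ) : ℂ)) heC
    (fun x g => by rw [hrel_long_of_pair F E c hcδ hδ hd v hT₂ hJ₂D D Dinv hDD Q hQm hQ μF χv s hf₀ _ hN₁eq w₁ w₂ hne hw μ₂ A₂ hA₂ _ hN₂'eq μ₁ A₁ hA₁ _ hN₂eq x g]; simp only [Nat.cast_ofNat, add_zero]; ring)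
    h (fun t ht => (K₀ : Subgroup (UnitaryGroup.localPi E c (2 + 2) J₂D v)).mul_mem ((K₀ : Subgroup (UnitaryGroup.localPi E c (2 + 2) J₂D v)).mul_mem ((K₀ : Subgroup (UnitaryGroup.localPi E c (2 + 2) J₂D v)).inv_mem hh) (hKu t ht)) hh)
    (fun t ht => (K₀ : Subgroup (UnitaryGroup.localPi E c (2 + 2) J₂D v)).mul_mem ((K₀ : Subgroup (UnitaryGroup.localPi E c (2 + 2) J₂D v)).mul_mem ((K₀ : Subgroup (UnitaryGroup.localPi E c (2 + 2) J₂D v)).inv_mem hh)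
      ((K₀ : Subgroup (UnitaryGroup.localPi E c (2 + 2) J₂D v)).mul_mem ((K₀ : Subgroup (UnitaryGroup.localPi E c (2 + 2) J₂D v)).mul_mem hKw₂ (hKū t ht)) hKw₂)) hh)
    (by rw [← one_mul (FrameTransport.frameConj F E c v (2 + 2) hJ₂D (antidiagonal_over_eq_map F E 2) Q hQ (toLocalFour F E c v (weylTwo (UnitaryGroup.LocalRing E v) (UnitaryGroup.conjLocal E c v))) * h), hN₂K 1 _ ((K₀ : Subgroup (UnitaryGroup.localPi E c (2 + 2) J₂D v)).mul_mem hKw₂ hh), ← hN₂K 1 h hh, one_mul])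
  -- the three point values `N₂ 1`, `N₂' 1`, `N₁ 1` by ★ (F-GK-1) at `y = 1`
  have hN₂h : N₂ h = N₂ 1 := by rw [← one_mul h, hN₂K 1 h hh]
  have hB1v := (integrable_and_integral_eq_of_level_zero μ₁ hN₂'K (u := fun ζ => FrameTransport.frameConj F E c v (2 + 2) hJ₂D (antidiagonal_over_eq_map F E 2) Q hQ (toLocalFour F E c v (uMinus (UnitaryGroup.LocalRing E v) (UnitaryGroup.conjLocal E c v) (UnitaryGroup.conjLocal_conjLocal c v hcδ hδ) (Pi.single w₁ ζ)))) (ū := fun ζ => FrameTransport.frameConj F E c v (2 + 2) hJ₂D (antidiagonal_over_eq_map F E 2) Q hQ (toLocalFour F E c v (leviElt (UnitaryGroup.LocalRing E v) (UnitaryGroup.conjLocal E c v) (UnitaryGroup.conjLocal_conjLocal c v hcδ hδ) A₁)) * FrameTransport.frameConj F E c v (2 + 2) hJ₂D (antidiagonal_over_eq_map F E 2) Q hQ (toLocalFour F E c v (uMinus (UnitaryGroup.LocalRing E v) (UnitaryGroup.conjLocal E c v) (UnitaryGroup.conjLocal_conjLocal c v hcδ hδ) (Pi.single w₁ ζ)))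 * FrameTransport.frameConj F E c v (2 + 2) hJ₂D (antidiagonal_over_eq_map F E 2) Q hQ (toLocalFour F E c v (leviElt (UnitaryGroup.LocalRing E v) (UnitaryGroup.conjLocal E c v) (UnitaryGroup.conjLocal_conjLocal c v hcδ hδ) A₁)))
    huB1add (FrameTransport.frameConj F E c v (2 + 2) hJ₂D (antidiagonal_over_eq_map F E 2) Q hQ (toLocalFour F E c v (leviElt (UnitaryGroup.LocalRing E v) (UnitaryGroup.conjLocal E c v) (UnitaryGroup.conjLocal_conjLocal c v hcδ hδ) A₁))) (chiNorm F E c v χv w₁) (norm_chiNorm_eq_one (F := F) (E := E) (c := c) hχ w₁) (((2 : ℕ) : ℂ) * s + 1) ((χv w₁ (-1) : ℂˣ) : ℂ) heB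
    (fun x g => by simpa only [Nat.cast_ofNat] using hrel_short₂ F E c hcδ hδ hd v hT₂ hJ₂D D Dinv hDD Q hQm hQ μF χv s hf₀ _ hN₁eq w₂ μ₂ A₂ hA₂ _ hN₂'eq w₁ hne A₁ hA₁ x g)
    1 (fun t ht => by simpa only [inv_one, one_mul, mul_one] using hKm₁ t ht)
    (fun t ht => by simpa only [inv_one, one_mul, mul_one] using (K₀ : Subgroup (UnitaryGroup.localPi E c (2 + 2) J₂D v)).mul_mem ((K₀ : Subgroup (UnitaryGroup.localPi E c (2 + 2) J₂D v)).mul_mem hKA₁ (hKm₁ t ht)) hKA₁)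
    (by rw [mul_one, ← one_mul (FrameTransport.frameConj F E c v (2 + 2) hJ₂D (antidiagonal_over_eq_map F E 2) Q hQ (toLocalFour F E c v (leviElt (UnitaryGroup.LocalRing E v) (UnitaryGroup.conjLocal E c v) (UnitaryGroup.conjLocal_conjLocal c v hcδ hδ) A₁))), hN₂'K 1 _ hKA₁])).2
  have hN₂one : N₂ 1 = (lFactor E w₁.1 (chiNorm F E c v χv w₁) (((2 : ℕ) : ℂ) * s + 1 - 1))⁻¹ * ((μ₁.real (primePowBall (w₁.1.adicCompletion E) 0) : ℂ) * (1 + ((χv w₁ (-1) : ℂˣ) : ℂ) * (1 - (residueFieldCard (w₁.1.adicCompletion E) : ℂ)⁻¹) * (unramValue E w₁.1 (chiNorm F E c v χv w₁) * (residueFieldCard (w₁.1.adicCompletion E) : ℂ) ^ (1 - (((2 : ℕ) : ℂ) * s + 1))) * lFactor E w₁.1 (chiNorm F E c v χv w₁) (((2 : ℕ) : ℂ) * s + 1 - 1)) * N₂' 1) := by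
    rw [hN₂eq 1]; simp only [mul_one] at hB1v ⊢; rw [hB1v]
  have hB2v := (integrable_and_integral_eq_of_level_zero μ₂ hN₁K (u := fun ζ => FrameTransport.frameConj F E c v (2 + 2) hJ₂D (antidiagonal_over_eq_map F E 2) Q hQ (toLocalFour F E c v (uMinus (UnitaryGroup.LocalRing E v) (UnitaryGroup.conjLocal E c v) (UnitaryGroup.conjLocal_conjLocal c v hcδ hδ) (Pi.single w₂ ζ)))) (ū := fun ζ => FrameTransport.frameConj F E c v (2 + 2) hJ₂D (antidiagonal_over_eq_map F E 2) Q hQ (toLocalFour F E c v (leviElt (UnitaryGroup.LocalRing E v) (UnitaryGroup.conjLocal E c v) (UnitaryGroup.conjLocal_conjLocal c v hcδ hδ) A₂)) * FrameTransport.frameConj F E c v (2 + 2) hJ₂D (antidiagonal_over_eq_map F E 2) Q hQ (toLocalFour F E c v (uMinus (UnitaryGroup.LocalRing E v) (UnitaryGroup.conjLocal E c v) (UnitaryGroup.conjLocal_conjLocal c v hcδ hδ) (Pi.single w₂ ζ))) * FrameTransport.frameConj F E c v (2 + 2) hJ₂D (antidiagonal_over_eq_map F E 2) Q hQ (toLocalFour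 F E c v (leviElt (UnitaryGroup.LocalRing E v) (UnitaryGroup.conjLocal E c v) (UnitaryGroup.conjLocal_conjLocal c v hcδ hδ) A₂)))
    huB2add (FrameTransport.frameConj F E c v (2 + 2) hJ₂D (antidiagonal_over_eq_map F E 2) Q hQ (toLocalFour F E c v (leviElt (UnitaryGroup.LocalRing E v) (UnitaryGroup.conjLocal E c v) (UnitaryGroup.conjLocal_conjLocal c v hcδ hδ) A₂))) (chiNorm F E c v χv w₂) (norm_chiNorm_eq_one (F := F) (E := E) (c := c) hχ w₂) (((2 : ℕ) : ℂ) * s + 1) ((χv w₂ (-1) : ℂˣ) : ℂ) heB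
    (fun x g => by simpa only [Nat.cast_ofNat] using hrel_short F E c hcδ hδ hd v hT₂ hJ₂D D Dinv hDD Q hQm hQ μF χv s hf₀ _ hN₁eq w₂ A₂ hA₂ x g)
    1 (fun t ht => by simpa only [inv_one, one_mul, mul_one] using hKm₂ t ht)
    (fun t ht => by simpa only [inv_one, one_mul, mul_one] using (K₀ : Subgroup (UnitaryGroup.localPi E c (2 + 2) J₂D v)).mul_mem ((K₀ : Subgroup (UnitaryGroup.localPi E c (2 + 2) J₂D v)).mul_mem hKA₂ (hKm₂ t ht)) hKA₂)
    (by rw [mul_one, ← one_mul (FrameTransport.frameConj F E c v (2 + 2) hJ₂D (antidiagonal_over_eq_map F E 2) Q hQ (toLocalFour F E c v (leviElt (UnitaryGroup.LocalRing E v) (UnitaryGroup.conjLocal E c v) (UnitaryGroup.conjLocal_conjLocal c v hcδ hδ) A₂))), hN₁K 1 _ hKA₂])).2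
  have hN₂'one : N₂' 1 = (lFactor E w₂.1 (chiNorm F E c v χv w₂) (((2 : ℕ) : ℂ) * s + 1 - 1))⁻¹ * ((μ₂.real (primePowBall (w₂.1.adicCompletion E) 0) : ℂ) * (1 + ((χv w₂ (-1) : ℂˣ) : ℂ) * (1 - (residueFieldCard (w₂.1.adicCompletion E) : ℂ)⁻¹) * (unramValue E w₂.1 (chiNorm F E c v χv w₂) * (residueFieldCard (w₂.1.adicCompletion E) : ℂ) ^ (1 - (((2 : ℕ) : ℂ) * s + 1))) * lFactor E w₂.1 (chiNorm F E c v χv w₂) (((2 : ℕ) : ℂ) * s + 1 - 1)) * N₁ 1) := by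
    rw [hN₂'eq 1]; simp only [mul_one] at hB2v ⊢; rw [hB2v]
  have hAv := (integrable_and_integral_eq_of_level_zero μF hfK (u := fun y => FrameTransport.frameConj F E c v (2 + 2) hJ₂D (antidiagonal_over_eq_map F E 2) Q hQ (toLocalFour F E c v (uLongTwo (UnitaryGroup.LocalRing E v) (UnitaryGroup.conjLocal E c v) (UnitaryGroup.toLocalRing E v y * algebraMap E (UnitaryGroup.LocalRing E v) δ) (conjLocal_coord F E c hcδ v y)))) (ū := fun t => FrameTransport.frameConj F E c v (2 + 2) hJ₂D (antidiagonal_over_eq_map F E 2) Q hQ (toLocalFour F E c v (weylTwo (UnitaryGroup.LocalRing E v) (UnitaryGroup.conjLocal E c v))) * FrameTransport.frameConj F E c v (2 + 2) hJ₂D (antidiagonal_over_eq_map F E 2) Q hQ (toLocalFour F E c v (uLongTwo (UnitaryGroup.LocalRing E v) (UnitaryGroup.conjLocal E c v) (UnitaryGroup.toLocalRing E v t * algebraMap E (UnitaryGroup.LocalRing E v) δ⁻¹) (conjLocal_coord_inv F E c hcδ v t))) * FrameTransport.frameConj F E c v (2 + 2) hJ₂D (antidiagonal_over_eq_map F E 2)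 Q hQ (toLocalFour F E c v (weylTwo (UnitaryGroup.LocalRing E v) (UnitaryGroup.conjLocal E c v))))
    (frameConj_uLongTwo_coord_add F E c hcδ v hJ₂D Q hQ) (FrameTransport.frameConj F E c v (2 + 2) hJ₂D (antidiagonal_over_eq_map F E 2) Q hQ (toLocalFour F E c v (weylTwo (UnitaryGroup.LocalRing E v) (UnitaryGroup.conjLocal E c v)))) (chiF F E v χv) (norm_chiF_eq_one (F := F) (E := E) hχ) (((2 : ℕ) : ℂ) * s + 2)
    (localSiegelCharacter F E c v 2 χv s (FrameTransport.frameConj F E c v (2 + 2) hJ₂D (antidiagonal_over_eq_map F E 2) Q hQ (toLocalFour F E c v (torusElt (UnitaryGroup.LocalRing E v) (UnitaryGroup.conjLocal E c v) (UnitaryGroup.conjLocal_conjLocal c v hcδ hδ) 1 (-((Units.mk0 δ hδ).map (algebraMap E (UnitaryGroup.LocalRing E v) : E →* UnitaryGroup.LocalRing E v))⁻¹))))) heA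
    (fun x g => by simpa only [Nat.cast_ofNat] using apply_weylTwo_uLongTwo_coord_of_isLocalSiegelSection F E c hcδ hδ hd v hT₂ hJ₂D D Dinv hDD Q hQm hQ χv s hf₀ x g)
    1 (fun t ht => by simpa only [inv_one, one_mul, mul_one] using hKu t ht)
    (fun t ht => by simpa only [inv_one, one_mul, mul_one] using (K₀ : Subgroup (UnitaryGroup.localPi E c (2 + 2) J₂D v)).mul_mem ((K₀ : Subgroup (UnitaryGroup.localPi E c (2 + 2) J₂D v)).mul_mem hKw₂ (hKū t ht)) hKw₂)
    (by rw [mul_one, ← one_mul (FrameTransport.frameConj F E c v (2 + 2) hJ₂D (antidiagonal_over_eq_map F E 2) Q hQ (toLocalFour F E c v (weylTwo (UnitaryGroup.LocalRing E v) (UnitaryGroup.conjLocal E c v)))), hfK 1 _ hKw₂])).2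
  have hN₁one : N₁ 1 = (lFactor F v (chiF F E v χv) (((2 : ℕ) : ℂ) * s + 2 - 1))⁻¹ * ((μF.real (primePowBall (v.adicCompletion F) 0) : ℂ) * (1 + localSiegelCharacter F E c v 2 χv s (FrameTransport.frameConj F E c v (2 + 2) hJ₂D (antidiagonal_over_eq_map F E 2) Q hQ (toLocalFour F E c v (torusElt (UnitaryGroup.LocalRing E v) (UnitaryGroup.conjLocal E c v) (UnitaryGroup.conjLocal_conjLocal c v hcδ hδ) 1 (-((Units.mk0 δ hδ).map (algebraMap E (UnitaryGroup.LocalRing E v) : E →* UnitaryGroup.LocalRing E v))⁻¹)))) * (1 - (residueFieldCard (v.adicCompletion F) : ℂ)⁻¹) * (unramValue F v (chiF F E v χv) * (residueFieldCard (v.adicCompletion F) : ℂ) ^ (1 - (((2 : ℕ) : ℂ) * s + 2))) * lFactor F v (chiF F E v χv) (((2 : ℕ) : ℂ) * s + 2 - 1)) * f₀ 1) := by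
    rw [hN₁eq 1]; simp only [mul_one] at hAv ⊢; rw [hAv]
  -- the integral as an iterated integral (★ B4d-3 with the majorant chain ★ B7-M2s)
  have hch := chain_integrability_of_pair F E c hcδ hδ hd v hT₂ hJ₂D D Dinv hDD Q hQm hQ μF e3 he3 hχ hs hf₀ hsm₀ K₀ hfK w₁ w₂ hne hw μ₁ μ₂ e₂ he₂ A₁ hA₁ A₂ hA₂ h
  rw [localIntertwining_eq_mul_integral_frameConj F E c hcδ hδ hd v hT₂ hJ₂D D Dinv hDD Q hQm hQ νN χv s hf₀ h,
    (integral_frameConj_weylSiegel_eq_iterated_of_chain F E c hcδ hδ v hJ₂D Q hQ e3 he3 νN μF (Measure.map (⇑e₂) (μ₁.prod μ₂)) cN hν f₀ h hch.1 hch.2.1 hch.2.2.1 hch.2.2.2).2]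
  -- the true family's Fubini exchange in the middle stage, dominated by the majorant (★ B7-M2s `hI2`)
  have hN₁cont : Continuous N₁ := continuous_of_isSmooth F E c v 2 ⟨K₀, hN₁K⟩
  have hN₁prod : ∀ X : UnitaryGroup.localPi E c (2 + 2) J₂D v, Integrable (fun p : (w₁.1.adicCompletion E × w₂.1.adicCompletion E) => N₁ (FrameTransport.frameConj F E c v (2 + 2) hJ₂D (antidiagonal_over_eq_map F E 2) Q hQ (toLocalFour F E c v (leviElt (UnitaryGroup.LocalRing E v) (UnitaryGroup.conjLocal E c v) (UnitaryGroup.conjLocal_conjLocal c v hcδ hδ) A₂)) * FrameTransport.frameConj F E c v (2 + 2) hJ₂D (antidiagonal_over_eq_map F E 2) Q hQ (toLocalFour F E c v (uMinus (UnitaryGroup.LocalRing E v) (UnitaryGroup.conjLocal E c v) (UnitaryGroup.conjLocal_conjLocal c v hcδ hδ) (Pi.single w₂ p.2))) * (FrameTransport.frameConj F E c v (2 + 2) hJ₂D (antidiagonal_over_eq_map F E 2) Q hQ (toLocalFour F E c v (leviElt (UnitaryGroup.LocalRing E v) (UnitaryGroup.conjLocal E c v) (UnitaryGroup.conjLocal_conjLocal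 c v hcδ hδ) A₁)) * FrameTransport.frameConj F E c v (2 + 2) hJ₂D (antidiagonal_over_eq_map F E 2) Q hQ (toLocalFour F E c v (uMinus (UnitaryGroup.LocalRing E v) (UnitaryGroup.conjLocal E c v) (UnitaryGroup.conjLocal_conjLocal c v hcδ hδ) (Pi.single w₁ p.1))) * X))) (μ₁.prod μ₂) := fun X => by
    refine integrable_of_norm_le_mul e₂ (hch.2.2.1 X) ?_ ‖(lFactor F v (chiF F E v χv) (((2 : ℕ) : ℂ) * s + 2 - 1))⁻¹‖ fun p => ?_
    · exact (hN₁cont.comp ((continuous_const.fun_mul (huB2.1.comp continuous_snd)).fun_mul ((continuous_const.fun_mul (huB1.1.comp continuous_fst)).fun_mul continuous_const))).aestronglyMeasurable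
    · rw [show e₂ p = e₂ (p.1, p.2) from rfl, he₂, hmid, hN₁eq, norm_mul]; exact mul_le_mul_of_nonneg_left (norm_integral_le_integral_norm _) (norm_nonneg _)
  have hfub : ∀ X : UnitaryGroup.localPi E c (2 + 2) J₂D v, ∫ p, N₁ (FrameTransport.frameConj F E c v (2 + 2) hJ₂D (antidiagonal_over_eq_map F E 2) Q hQ (toLocalFour F E c v (leviElt (UnitaryGroup.LocalRing E v) (UnitaryGroup.conjLocal E c v) (UnitaryGroup.conjLocal_conjLocal c v hcδ hδ) A₂)) * FrameTransport.frameConj F E c v (2 + 2) hJ₂D (antidiagonal_over_eq_map F E 2) Q hQ (toLocalFour F E c v (uMinus (UnitaryGroup.LocalRing E v) (UnitaryGroup.conjLocal E c v) (UnitaryGroup.conjLocal_conjLocal c v hcδ hδ) (Pi.single w₂ p.2))) * (FrameTransport.frameConj F E c v (2 + 2) hJ₂D (antidiagonal_over_eq_map F E 2) Q hQ (toLocalFour F E c v (leviElt (UnitaryGroup.LocalRing E v) (UnitaryGroup.conjLocal E c v) (UnitaryGroup.conjLocal_conjLocal c v hcδ hδ) A₁)) * FrameTransport.frameConj F E c v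 (2 + 2) hJ₂D (antidiagonal_over_eq_map F E 2) Q hQ (toLocalFour F E c v (uMinus (UnitaryGroup.LocalRing E v) (UnitaryGroup.conjLocal E c v) (UnitaryGroup.conjLocal_conjLocal c v hcδ hδ) (Pi.single w₁ p.1))) * X)) ∂(μ₁.prod μ₂) =
      ∫ ζ₁, ∫ ζ₂, N₁ (FrameTransport.frameConj F E c v (2 + 2) hJ₂D (antidiagonal_over_eq_map F E 2) Q hQ (toLocalFour F E c v (leviElt (UnitaryGroup.LocalRing E v) (UnitaryGroup.conjLocal E c v) (UnitaryGroup.conjLocal_conjLocal c v hcδ hδ) A₂)) * FrameTransport.frameConj F E c v (2 + 2) hJ₂D (antidiagonal_over_eq_map F E 2) Q hQ (toLocalFour F E c v (uMinus (UnitaryGroup.LocalRing E v) (UnitaryGroup.conjLocal E c v) (UnitaryGroup.conjLocal_conjLocal c v hcδ hδ) (Pi.single w₂ ζ₂))) * (FrameTransport.frameConj F E c v (2 + 2) hJ₂D (antidiagonal_over_eq_map F E 2) Q hQ (toLocalFour F E c v (leviElt (UnitaryGroup.LocalRing E v) (UnitaryGroup.conjLocal E c v) (UnitaryGroup.conjLocal_conjLocal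 c v hcδ hδ) A₁)) * FrameTransport.frameConj F E c v (2 + 2) hJ₂D (antidiagonal_over_eq_map F E 2) Q hQ (toLocalFour F E c v (uMinus (UnitaryGroup.LocalRing E v) (UnitaryGroup.conjLocal E c v) (UnitaryGroup.conjLocal_conjLocal c v hcδ hδ) (Pi.single w₁ ζ₁))) * X)) ∂μ₂ ∂μ₁ := fun X => integral_prod _ (hN₁prod X)
  -- evaluate the four stages
  have hB₂int : ∀ g, ∫ ζ, N₁ (FrameTransport.frameConj F E c v (2 + 2) hJ₂D (antidiagonal_over_eq_map F E 2) Q hQ (toLocalFour F E c v (leviElt (UnitaryGroup.LocalRing E v) (UnitaryGroup.conjLocal E c v) (UnitaryGroup.conjLocal_conjLocal c v hcδ hδ) A₂)) * FrameTransport.frameConj F E c v (2 + 2) hJ₂D (antidiagonal_over_eq_map F E 2) Q hQ (toLocalFour F E c v (uMinus (UnitaryGroup.LocalRing E v) (UnitaryGroup.conjLocal E c v) (UnitaryGroup.conjLocal_conjLocal c v hcδ hδ) (Pi.single w₂ ζ))) * g) ∂μ₂ = lFactor E w₂.1 (chiNorm F E c v χv w₂) (((2 : ℕ) : ℂ) *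 s + 1 - 1) * N₂' g := fun g => (hN₂' g)
  have hB₁int : ∀ g, ∫ ζ, N₂' (FrameTransport.frameConj F E c v (2 + 2) hJ₂D (antidiagonal_over_eq_map F E 2) Q hQ (toLocalFour F E c v (leviElt (UnitaryGroup.LocalRing E v) (UnitaryGroup.conjLocal E c v) (UnitaryGroup.conjLocal_conjLocal c v hcδ hδ) A₁)) * FrameTransport.frameConj F E c v (2 + 2) hJ₂D (antidiagonal_over_eq_map F E 2) Q hQ (toLocalFour F E c v (uMinus (UnitaryGroup.LocalRing E v) (UnitaryGroup.conjLocal E c v) (UnitaryGroup.conjLocal_conjLocal c v hcδ hδ) (Pi.single w₁ ζ))) * g) ∂μ₁ = lFactor E w₁.1 (chiNorm F E c v χv w₁) (((2 : ℕ) : ℂ) * s + 1 - 1) * N₂ g := fun g => (hN₂ g)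
  have inner : ∀ (x : v.adicCompletion F) (z : UnitaryGroup.LocalRing E v),
      ∫ y, f₀ (FrameTransport.frameConj F E c v (2 + 2) hJ₂D (antidiagonal_over_eq_map F E 2) Q hQ (toLocalFour F E c v (weylTwo (UnitaryGroup.LocalRing E v) (UnitaryGroup.conjLocal E c v))) * FrameTransport.frameConj F E c v (2 + 2) hJ₂D (antidiagonal_over_eq_map F E 2) Q hQ (toLocalFour F E c v (uLongTwo (UnitaryGroup.LocalRing E v) (UnitaryGroup.conjLocal E c v) (UnitaryGroup.toLocalRing E v y * algebraMap E (UnitaryGroup.LocalRing E v) δ) (conjLocal_coord F E c hcδ v y))) *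
            (FrameTransport.frameConj F E c v (2 + 2) hJ₂D (antidiagonal_over_eq_map F E 2) Q hQ (toLocalFour F E c v (weylOne (UnitaryGroup.LocalRing E v) (UnitaryGroup.conjLocal E c v))) * FrameTransport.frameConj F E c v (2 + 2) hJ₂D (antidiagonal_over_eq_map F E 2) Q hQ (toLocalFour F E c v (uMinus (UnitaryGroup.LocalRing E v) (UnitaryGroup.conjLocal E c v) (UnitaryGroup.conjLocal_conjLocal c v hcδ hδ) z)) *
              (FrameTransport.frameConj F E c v (2 + 2) hJ₂D (antidiagonal_over_eq_map F E 2) Q hQ (toLocalFour F E c v (weylTwo (UnitaryGroup.LocalRing E v) (UnitaryGroup.conjLocal E c v))) * FrameTransport.frameConj F E c v (2 + 2) hJ₂D (antidiagonal_over_eq_map F E 2) Q hQ (toLocalFour F E c v (uLongTwo (UnitaryGroup.LocalRing E v) (UnitaryGroup.conjLocal E c v) (UnitaryGroup.toLocalRing E v x * algebraMap E (UnitaryGroup.LocalRing E v) δ) (conjLocal_coord F E c hcδ v x))) * h))) ∂μF =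
        lFactor F v (chiF F E v χv) (((2 : ℕ) : ℂ) * s + 2 - 1) * N₁ (FrameTransport.frameConj F E c v (2 + 2) hJ₂D (antidiagonal_over_eq_map F E 2) Q hQ (toLocalFour F E c v (weylOne (UnitaryGroup.LocalRing E v) (UnitaryGroup.conjLocal E c v))) * FrameTransport.frameConj F E c v (2 + 2) hJ₂D (antidiagonal_over_eq_map F E 2) Q hQ (toLocalFour F E c v (uMinus (UnitaryGroup.LocalRing E v) (UnitaryGroup.conjLocal E c v) (UnitaryGroup.conjLocal_conjLocal c v hcδ hδ) z)) *
              (FrameTransport.frameConj F E c v (2 + 2) hJ₂D (antidiagonal_over_eq_map F E 2) Q hQ (toLocalFour F E c v (weylTwo (UnitaryGroup.LocalRing E v) (UnitaryGroup.conjLocal E c v))) * FrameTransport.frameConj F E c v (2 + 2) hJ₂D (antidiagonal_over_eq_map F E 2) Q hQ (toLocalFour F E c v (uLongTwo (UnitaryGroup.LocalRing E v) (UnitaryGroup.conjLocal E c v) (UnitaryGroup.toLocalRing E v x * algebraMap E (UnitaryGroup.LocalRing E v) δ) (conjLocal_coord F E c hcδ v x))) * h)) := fun x z => (hN₁ _)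
  have middle : ∀ x : v.adicCompletion F,
      ∫ z, lFactor F v (chiF F E v χv) (((2 : ℕ) : ℂ) * s + 2 - 1) * N₁ (FrameTransport.frameConj F E c v (2 + 2) hJ₂D (antidiagonal_over_eq_map F E 2) Q hQ (toLocalFour F E c v (weylOne (UnitaryGroup.LocalRing E v) (UnitaryGroup.conjLocal E c v))) * FrameTransport.frameConj F E c v (2 + 2) hJ₂D (antidiagonal_over_eq_map F E 2) Q hQ (toLocalFour F E c v (uMinus (UnitaryGroup.LocalRing E v) (UnitaryGroup.conjLocal E c v) (UnitaryGroup.conjLocal_conjLocal c v hcδ hδ) z)) *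
              (FrameTransport.frameConj F E c v (2 + 2) hJ₂D (antidiagonal_over_eq_map F E 2) Q hQ (toLocalFour F E c v (weylTwo (UnitaryGroup.LocalRing E v) (UnitaryGroup.conjLocal E c v))) * FrameTransport.frameConj F E c v (2 + 2) hJ₂D (antidiagonal_over_eq_map F E 2) Q hQ (toLocalFour F E c v (uLongTwo (UnitaryGroup.LocalRing E v) (UnitaryGroup.conjLocal E c v) (UnitaryGroup.toLocalRing E v x * algebraMap E (UnitaryGroup.LocalRing E v) δ) (conjLocal_coord F E c hcδ v x))) * h)) ∂(Measure.map (⇑e₂) (μ₁.prod μ₂)) =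
        lFactor F v (chiF F E v χv) (((2 : ℕ) : ℂ) * s + 2 - 1) * (lFactor E w₂.1 (chiNorm F E c v χv w₂) (((2 : ℕ) : ℂ) * s + 1 - 1) * (lFactor E w₁.1 (chiNorm F E c v χv w₁) (((2 : ℕ) : ℂ) * s + 1 - 1) *
          N₂ (FrameTransport.frameConj F E c v (2 + 2) hJ₂D (antidiagonal_over_eq_map F E 2) Q hQ (toLocalFour F E c v (weylTwo (UnitaryGroup.LocalRing E v) (UnitaryGroup.conjLocal E c v))) * FrameTransport.frameConj F E c v (2 + 2) hJ₂D (antidiagonal_over_eq_map F E 2) Q hQ (toLocalFour F E c v (uLongTwo (UnitaryGroup.LocalRing E v) (UnitaryGroup.conjLocal E c v) (UnitaryGroup.toLocalRing E v x * algebraMap E (UnitaryGroup.LocalRing E v) δ) (conjLocal_coord F E c hcδ v x))) * h))) := fun x => by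
    rw [hμRint, integral_const_mul]; simp only [hmid]; rw [hfub, integral_congr_ae (Filter.Eventually.of_forall fun ζ₁ => hB₂int _), integral_const_mul, hB₁int]
  have outer : ∫ x, lFactor F v (chiF F E v χv) (((2 : ℕ) : ℂ) * s + 2 - 1) * (lFactor E w₂.1 (chiNorm F E c v χv w₂) (((2 : ℕ) : ℂ) * s + 1 - 1) * (lFactor E w₁.1 (chiNorm F E c v χv w₁) (((2 : ℕ) : ℂ) * s + 1 - 1) *
          N₂ (FrameTransport.frameConj F E c v (2 + 2) hJ₂D (antidiagonal_over_eq_map F E 2) Q hQ (toLocalFour F E c v (weylTwo (UnitaryGroup.LocalRing E v) (UnitaryGroup.conjLocal E c v))) * FrameTransport.frameConj F E c v (2 + 2) hJ₂D (antidiagonal_over_eq_map F E 2) Q hQ (toLocalFour F E c v (uLongTwo (UnitaryGroup.LocalRing E v) (UnitaryGroup.conjLocal E c v) (UnitaryGroup.toLocalRing E v x * algebraMap E (UnitaryGroup.LocalRing E v) δ) (conjLocal_coord F E c hcδ v x))) * h))) ∂μF =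
        lFactor F v (chiF F E v χv) (((2 : ℕ) : ℂ) * s + 2 - 1) * (lFactor E w₂.1 (chiNorm F E c v χv w₂) (((2 : ℕ) : ℂ) * s + 1 - 1) * (lFactor E w₁.1 (chiNorm F E c v χv w₁) (((2 : ℕ) : ℂ) * s + 1 - 1) *
          ((μF.real (primePowBall (v.adicCompletion F) 0) : ℂ) *
            (1 + (localSiegelCharacter F E c v 2 χv s (FrameTransport.frameConj F E c v (2 + 2) hJ₂D (antidiagonal_over_eq_map F E 2) Q hQ (toLocalFour F E c v (torusElt (UnitaryGroup.LocalRing E v) (UnitaryGroup.conjLocal E c v) (UnitaryGroup.conjLocal_conjLocal c v hcδ hδ) (-((Units.mk0 δ hδ).map (algebraMap E (UnitaryGroup.LocalRing E v) : E →* UnitaryGroup.LocalRing E v))⁻¹) 1))) * ((∏ w' : PlacesOver E v, ‖algebraMap E (UnitaryGroup.LocalRing E v) δ w'‖ : ℝ) : ℂ)) * (1 - (residueFieldCard (v.adicCompletion F) : ℂ)⁻¹) *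
              (unramValue F v (chiF F E v χv) * (residueFieldCard (v.adicCompletion F) : ℂ) ^ (1 - (((2 : ℕ) : ℂ) * s + 0))) * lFactor F v (chiF F E v χv) (((2 : ℕ) : ℂ) * s + 0 - 1)) * N₂ h))) := by
    rw [integral_const_mul, integral_const_mul, integral_const_mul, hC.2]
  -- point values and the cancellation of the three normalising `L`-factors
  simp_rw [inner, middle]; rw [outer, hN₂h, hN₂one, hN₂'one, hN₁one]
  generalize lFactor F v (chiF F E v χv) (((2 : ℕ) : ℂ) * s + 2 - 1) = LA at hLA ⊢
  generalize lFactor E w₁.1 (chiNorm F E c v χv w₁) (((2 : ℕ) : ℂ) * s + 1 - 1) = LB₁ at hLB₁ ⊢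
  generalize lFactor E w₂.1 (chiNorm F E c v χv w₂) (((2 : ℕ) : ℂ) * s + 1 - 1) = LB₂ at hLB₂ ⊢
  exact cancel_three hLA hLB₁ hLB₂

include hcδ hδ hd hT₂ hDD hDD' hQm hQ in
/-- **THE SIEGEL INTERTWINING OPERATOR ON A `K₀`-SPHERICAL SECTION, BY THE COCYCLE (split place, raw form)** — the split twin of ★ (F-GK-2)
`localIntertwining_eq_of_spherical_of_forall_eq`, same letters with `(w₁ w₂ hne hw)` and the two Levi elements `ℓ_{A₁}`, `ℓ_{A₂}`.  Let `χ_v` be unitary,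
`1 < re s`, `f ∈ I_v(s, χ_v)` a smooth Siegel section right-invariant under an OPEN subgroup `K₀` containing the cocycle's letters at integral points —
`φ(w₂)`, `φ(ℓ_{A₁})`, `φ(ℓ_{A₂})`, `φ(u_{2e₂}(ι_v(t)δ^{±1}))` (`t ∈ 𝒪_{F_v}`), `φ(u₋(1_{wᵢ} ζ))` (`ζ ∈ 𝒪_{E_{wᵢ}}`) — and `h ∈ K₀`.  Then
`M_v(s) f (h) = χ_s(m₀) · νN(BOX) · G_A G_{B₁} G_{B₂} G_C · f(h)`, `G_i = 1 + C_i (1 − q_i⁻¹)(α_i q_i^{1−e_i}) L(e_i − 1, ν_i)` with the cocycle's data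
`(C_A, ν_A, e_A) = (χ_s(φ t(1,−δ⁻¹)), χ_{F,v}, 2s+2)` (★ B4d-1b), `(C_{Bᵢ}, ν_{Bᵢ}, e_{Bᵢ}) = (χ_{wᵢ}(−1), χ_{wᵢ}·(χ_{w̄ᵢ}∘c), 2s+1)` (★ B7-CB §3), `(C_C, ν_C, e_C) =
(χ_s(φ t(−δ⁻¹,1))·∏_w‖δ_w‖, χ_{F,v}, 2s)` (★ B7-CC), `m₀ = w_Δ φ(w_Δ^J)` (★ B4d-3), `BOX` the integral coordinate box of §1 — FOUR stages, each
evaluated by ★ (F-GK-1) at a point of level `0` (`localIntertwining_eq_of_spherical_of_pair_coord` + §1 `measureReal_box_eq_of_pair`).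
[cite: Casselman1980, §3 Thm. 3.1] [cite: KudlaSweet1997, §1] [cite: HarrisKudlaSweet1996, §6 (6.16)] -/
theorem localIntertwining_eq_of_spherical_of_pair
    [MeasurableSpace (unipDeltaLocal F E c v 2 (JD := J₂D))] [BorelSpace (unipDeltaLocal F E c v 2 (JD := J₂D))]
    (νN : Measure (unipDeltaLocal F E c v 2 (JD := J₂D))) [νN.IsHaarMeasure]
    (χv : ∀ w : PlacesOver E v, (w.1.adicCompletion E)ˣ →* ℂˣ) (hχ : ∀ (w' : PlacesOver E v) (x : (w'.1.adicCompletion E)ˣ), ‖((χv w' x : ℂˣ) : ℂ)‖ = 1)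
    (K₀ : Subgroup (UnitaryGroup.localPi E c (2 + 2) J₂D v)) (hK₀ : IsOpen (K₀ : Set (UnitaryGroup.localPi E c (2 + 2) J₂D v)))
    {s : ℂ} (hs : 1 < s.re) {f : UnitaryGroup.localPi E c (2 + 2) J₂D v → ℂ} (hSieg : IsLocalSiegelSection F E c hcδ hδ hd v 2 hT₂ hJ₂D χv s f) (hsm : IsSmooth F E c v 2 f)
    (hfK : ∀ g, ∀ k ∈ K₀, f (g * k) = f g)
    (w₁ w₂ : PlacesOver E v) (hne : w₁ ≠ w₂) (hw : ∀ w' : PlacesOver E v, w' = w₁ ∨ w' = w₂)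
    (A₁ : GL (Fin 2) (UnitaryGroup.LocalRing E v)) (hA₁ : A₁.val = !![1 - Pi.single w₁ 1, Pi.single w₁ 1; Pi.single w₁ 1, 1 - Pi.single w₁ 1])
    (A₂ : GL (Fin 2) (UnitaryGroup.LocalRing E v)) (hA₂ : A₂.val = !![1 - Pi.single w₂ 1, Pi.single w₂ 1; Pi.single w₂ 1, 1 - Pi.single w₂ 1])
    (hKw₂ : FrameTransport.frameConj F E c v (2 + 2) hJ₂D (antidiagonal_over_eq_map F E 2) Q hQ (toLocalFour F E c v (weylTwo (UnitaryGroup.LocalRing E v) (UnitaryGroup.conjLocal E c v))) ∈ K₀) (hKA₁ : FrameTransport.frameConj F E c v (2 + 2) hJ₂D (antidiagonal_over_eq_map F E 2) Q hQ (toLocalFour F E c v (leviElt (UnitaryGroup.LocalRing E v) (UnitaryGroup.conjLocal E c v) (UnitaryGroup.conjLocal_conjLocal c v hcδ hδ) A₁)) ∈ K₀) (hKA₂ : FrameTransport.frameConj F E c v (2 + 2) hJ₂D (antidiagonal_over_eq_map F E 2) Q hQ (toLocalFour F E c v (leviElt (UnitaryGroup.LocalRing E v) (UnitaryGroup.conjLocal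 E c v) (UnitaryGroup.conjLocal_conjLocal c v hcδ hδ) A₂)) ∈ K₀)
    (hKu : ∀ t ∈ primePowBall (v.adicCompletion F) 0, FrameTransport.frameConj F E c v (2 + 2) hJ₂D (antidiagonal_over_eq_map F E 2) Q hQ (toLocalFour F E c v (uLongTwo (UnitaryGroup.LocalRing E v) (UnitaryGroup.conjLocal E c v) (UnitaryGroup.toLocalRing E v t * algebraMap E (UnitaryGroup.LocalRing E v) δ) (conjLocal_coord F E c hcδ v t))) ∈ K₀)
    (hKū : ∀ t ∈ primePowBall (v.adicCompletion F) 0, FrameTransport.frameConj F E c v (2 + 2) hJ₂D (antidiagonal_over_eq_map F E 2) Q hQ (toLocalFour F E c v (uLongTwo (UnitaryGroup.LocalRing E v) (UnitaryGroup.conjLocal E c v) (UnitaryGroup.toLocalRing E v t * algebraMap E (UnitaryGroup.LocalRing E v) δ⁻¹) (conjLocal_coord_inv F E c hcδ v t))) ∈ K₀)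
    (hKm₁ : ∀ ζ ∈ primePowBall (w₁.1.adicCompletion E) 0, FrameTransport.frameConj F E c v (2 + 2) hJ₂D (antidiagonal_over_eq_map F E 2) Q hQ (toLocalFour F E c v (uMinus (UnitaryGroup.LocalRing E v) (UnitaryGroup.conjLocal E c v) (UnitaryGroup.conjLocal_conjLocal c v hcδ hδ) (Pi.single w₁ ζ))) ∈ K₀) (hKm₂ : ∀ ζ ∈ primePowBall (w₂.1.adicCompletion E) 0, FrameTransport.frameConj F E c v (2 + 2) hJ₂D (antidiagonal_over_eq_map F E 2) Q hQ (toLocalFour F E c v (uMinus (UnitaryGroup.LocalRing E v) (UnitaryGroup.conjLocal E c v) (UnitaryGroup.conjLocal_conjLocal c v hcδ hδ) (Pi.single w₂ ζ))) ∈ K₀)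
    (h : UnitaryGroup.localPi E c (2 + 2) J₂D v) (hh : h ∈ K₀) :
    localIntertwining F E c v 2 hJ₂D νN f h =
      localSiegelCharacter F E c v 2 χv s (weylDelta F E c v 2 hJ₂D (T₀ := T₂) * FrameTransport.frameConj F E c v (2 + 2) hJ₂D (antidiagonal_over_eq_map F E 2) Q hQ (toLocalFour F E c v (weylSiegel (UnitaryGroup.LocalRing E v) (UnitaryGroup.conjLocal E c v)))) * (νN.real {u : unipDeltaLocal F E c v 2 (JD := J₂D) | ∃ b₁ ∈ primePowBall (v.adicCompletion F) 0, ∃ ζ₁ ∈ primePowBall (w₁.1.adicCompletion E) 0, ∃ ζ₂ ∈ primePowBall (w₂.1.adicCompletion E) 0, ∃ b₂ ∈ primePowBall (v.adicCompletion F) 0, (u : UnitaryGroup.localPi E c (2 + 2) J₂D v) = FrameTransport.frameConj F E c v (2 + 2) hJ₂D (antidiagonal_over_eq_map F E 2) Q hQ (toLocalFour F E c v (nSiegel (UnitaryGroup.LocalRing E v) (UnitaryGroup.conjLocal E c v) (UnitaryGroup.conjLocal_conjLocal c v hcδ hδ) (UnitaryGroup.toLocalRing E v b₁ * algebraMap E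 (UnitaryGroup.LocalRing E v) δ) (Pi.single w₁ ζ₁ + Pi.single w₂ ζ₂) (UnitaryGroup.toLocalRing E v b₂ * algebraMap E (UnitaryGroup.LocalRing E v) δ) (conjLocal_coord F E c hcδ v b₁) (conjLocal_coord F E c hcδ v b₂)))} : ℂ) *
        ((1 + localSiegelCharacter F E c v 2 χv s (FrameTransport.frameConj F E c v (2 + 2) hJ₂D (antidiagonal_over_eq_map F E 2) Q hQ (toLocalFour F E c v (torusElt (UnitaryGroup.LocalRing E v) (UnitaryGroup.conjLocal E c v) (UnitaryGroup.conjLocal_conjLocal c v hcδ hδ) (1) (-((Units.mk0 δ hδ).map (algebraMap E (UnitaryGroup.LocalRing E v) : E →* UnitaryGroup.LocalRing E v))⁻¹)))) * (1 - (residueFieldCard (v.adicCompletion F) : ℂ)⁻¹) * (unramValue F v (chiF F E v χv) * (residueFieldCard (v.adicCompletion F) : ℂ) ^ (1 - (2 * s + 2))) * lFactor F v (chiF F E v χv) ((2 * s + 2) - 1)) *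
          (1 + ((χv w₁ (-1) : ℂˣ) : ℂ) * (1 - (residueFieldCard (w₁.1.adicCompletion E) : ℂ)⁻¹) * (unramValue E w₁.1 (chiNorm F E c v χv w₁) * (residueFieldCard (w₁.1.adicCompletion E) : ℂ) ^ (1 - (2 * s + 1))) * lFactor E w₁.1 (chiNorm F E c v χv w₁) ((2 * s + 1) - 1)) *
          (1 + ((χv w₂ (-1) : ℂˣ) : ℂ) * (1 - (residueFieldCard (w₂.1.adicCompletion E) : ℂ)⁻¹) * (unramValue E w₂.1 (chiNorm F E c v χv w₂) * (residueFieldCard (w₂.1.adicCompletion E) : ℂ) ^ (1 - (2 * s + 1))) * lFactor E w₂.1 (chiNorm F E c v χv w₂) ((2 * s + 1) - 1)) *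
          (1 + (localSiegelCharacter F E c v 2 χv s (FrameTransport.frameConj F E c v (2 + 2) hJ₂D (antidiagonal_over_eq_map F E 2) Q hQ (toLocalFour F E c v (torusElt (UnitaryGroup.LocalRing E v) (UnitaryGroup.conjLocal E c v) (UnitaryGroup.conjLocal_conjLocal c v hcδ hδ) (-((Units.mk0 δ hδ).map (algebraMap E (UnitaryGroup.LocalRing E v) : E →* UnitaryGroup.LocalRing E v))⁻¹) (1)))) * ((∏ w' : PlacesOver E v, ‖algebraMap E (UnitaryGroup.LocalRing E v) δ w'‖ : ℝ) : ℂ)) * (1 - (residueFieldCard (v.adicCompletion F) : ℂ)⁻¹) * (unramValue F v (chiF F E v χv) * (residueFieldCard (v.adicCompletion F) : ℂ) ^ (1 - (2 * s))) * lFactor F v (chiF F E v χv) ((2 * s) - 1))) * f h := by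
  -- topology and measures on `F_v`, `E_{w₁}`, `E_{w₂}`, `E ⊗ F_v` (as ★ B7s)
  haveI := secondCountableTopology_adicCompletion F v
  haveI : ∀ w' : PlacesOver E v, SecondCountableTopology (w'.1.adicCompletion E) := fun w' => secondCountableTopology_adicCompletion E w'.1
  borelize (v.adicCompletion F) (w₁.1.adicCompletion E) (w₂.1.adicCompletion E) (UnitaryGroup.LocalRing E v)
  obtain ⟨μF, hμF⟩ : ∃ μ : Measure (v.adicCompletion F), μ.IsAddHaarMeasure := ⟨Measure.addHaar, inferInstance⟩
  obtain ⟨μ₁, hμ₁⟩ : ∃ μ : Measure (w₁.1.adicCompletion E), μ.IsAddHaarMeasure := ⟨Measure.addHaar, inferInstance⟩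
  obtain ⟨μ₂, hμ₂⟩ : ∃ μ : Measure (w₂.1.adicCompletion E), μ.IsAddHaarMeasure := ⟨Measure.addHaar, inferInstance⟩
  haveI hμ12 : (μ₁.prod μ₂).IsAddHaarMeasure := Measure.prod.instIsAddHaarMeasure μ₁ μ₂
  obtain ⟨e₂, he₂, he₂add⟩ := exists_homeomorph_single_add_single F E v w₁ w₂ hne hw
  haveI hμR : (Measure.map (⇑e₂) (μ₁.prod μ₂)).IsAddHaarMeasure :=
    AddEquiv.isAddHaarMeasure_map (μ₁.prod μ₂) ({ toFun := e₂, invFun := e₂.symm, left_inv := e₂.symm_apply_apply, right_inv := e₂.apply_symm_apply, map_add' := he₂add } :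
      (w₁.1.adicCompletion E × w₂.1.adicCompletion E) ≃+ UnitaryGroup.LocalRing E v) e₂.continuous e₂.symm.continuous
  -- the coordinates of `N_Δ(F_v)` and the Haar relation (★ B1b-2b, ★ B4d-3)
  obtain ⟨e3, he3'⟩ := exists_homeomorph_coordTwo F E c hcδ hδ v hJ₂D D Dinv hDD hDD' Q hQm hQ
  obtain ⟨cN, -, hν⟩ := exists_measure_eq_smul_map F E c v e3 he3'.2 νN μF (Measure.map (⇑e₂) (μ₁.prod μ₂))
  have hfh : f h = f 1 := by simpa only [one_mul] using hfK 1 h hh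
  rw [localIntertwining_eq_of_spherical_of_pair_coord F E c hcδ hδ hd v hT₂ hJ₂D D Dinv hDD Q hQm hQ νN χv hχ hs f hSieg hsm ⟨K₀, hK₀⟩ hfK w₁ w₂ hne hw μF μ₁ μ₂ e₂ he₂ A₁ hA₁ A₂ hA₂ e3 he3'.1 cN hν hKw₂ hKA₁ hKA₂ hKu hKū hKm₁ hKm₂ h hh,
    measureReal_box_eq_of_pair F E c hcδ hδ v hJ₂D Q hQ e3 he3'.1 νN μF w₁ w₂ μ₁ μ₂ e₂ he₂ cN hν, hfh]
  push_cast
  simp only [add_zero]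
  ring

/-! ## §3 The Gindikin–Karpelevich value `aNorm 2 χ_v vol s` at a split place -/

set_option maxHeartbeats 400000 in -- MEASURED: > 200 000 at `whnf` on the binder telescope (as ★ (F-GK-2) §2), ≤ 400 000
include hcδ hδ hd hT₂ hDD hDD' hQm hQ in
/-- **THE GINDIKIN–KARPELEVICH VALUE OF THE SIEGEL INTERTWINING OPERATOR ON A SPHERICAL SECTION (split place)** — the split twin of ★ (F-GK-2)
`localIntertwining_eq_aNorm_mul_of_spherical_of_forall_eq`.  Under the hypotheses of `localIntertwining_eq_of_spherical_of_pair`, if the five unit scalars of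
the cocycle are trivial — `χ_s(m₀) = 1`, `χ_s(φ t(1,−δ⁻¹)) = 1`, `χ_{w₁}(−1) = 1`, `χ_{w₂}(−1) = 1`, `χ_s(φ t(−δ⁻¹,1))·∏_w‖δ_w‖ = 1` (a good place) — then
**`M_v(s) f (h) = aNorm 2 χ_v (νN(BOX)) s · f(h)`**, `aNorm 2 χ_v vol s = vol · L_F(2s−1,χ_F) L_{E⊗F_v}(2s) L_F(2s+1) ∕ (L_F(2s) L_F(2s+2) L_{E⊗F_v}(2s+1))` (★ T1 `aNorm_two`,
`L_{E⊗F_v} = L_{E_{w₁}} · L_{E_{w₂}}` by `Fintype.prod_eq_mul` over the pair) — the product of the FOUR spherical rank-one ratios `L(e−1)∕L(e)`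
(★ (F-GK-1) `one_add_eq_lFactor_div_lFactor`). [cite: Casselman1980, §3 Thm. 3.1] [cite: HarrisKudlaSweet1996, §6 (6.16)] [cite: KudlaSweet1997, §1] -/
theorem localIntertwining_eq_aNorm_mul_of_spherical_of_pair
    [MeasurableSpace (unipDeltaLocal F E c v 2 (JD := J₂D))] [BorelSpace (unipDeltaLocal F E c v 2 (JD := J₂D))]
    (νN : Measure (unipDeltaLocal F E c v 2 (JD := J₂D))) [νN.IsHaarMeasure]
    (χv : ∀ w : PlacesOver E v, (w.1.adicCompletion E)ˣ →* ℂˣ) (hχ : ∀ (w' : PlacesOver E v) (x : (w'.1.adicCompletion E)ˣ), ‖((χv w' x : ℂˣ) : ℂ)‖ = 1)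
    (K₀ : Subgroup (UnitaryGroup.localPi E c (2 + 2) J₂D v)) (hK₀ : IsOpen (K₀ : Set (UnitaryGroup.localPi E c (2 + 2) J₂D v)))
    {s : ℂ} (hs : 1 < s.re) {f : UnitaryGroup.localPi E c (2 + 2) J₂D v → ℂ} (hSieg : IsLocalSiegelSection F E c hcδ hδ hd v 2 hT₂ hJ₂D χv s f) (hsm : IsSmooth F E c v 2 f)
    (hfK : ∀ g, ∀ k ∈ K₀, f (g * k) = f g)
    (w₁ w₂ : PlacesOver E v) (hne : w₁ ≠ w₂) (hw : ∀ w' : PlacesOver E v, w' = w₁ ∨ w' = w₂)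
    (A₁ : GL (Fin 2) (UnitaryGroup.LocalRing E v)) (hA₁ : A₁.val = !![1 - Pi.single w₁ 1, Pi.single w₁ 1; Pi.single w₁ 1, 1 - Pi.single w₁ 1])
    (A₂ : GL (Fin 2) (UnitaryGroup.LocalRing E v)) (hA₂ : A₂.val = !![1 - Pi.single w₂ 1, Pi.single w₂ 1; Pi.single w₂ 1, 1 - Pi.single w₂ 1])
    (hKw₂ : FrameTransport.frameConj F E c v (2 + 2) hJ₂D (antidiagonal_over_eq_map F E 2) Q hQ (toLocalFour F E c v (weylTwo (UnitaryGroup.LocalRing E v) (UnitaryGroup.conjLocal E c v))) ∈ K₀) (hKA₁ : FrameTransport.frameConj F E c v (2 + 2) hJ₂D (antidiagonal_over_eq_map F E 2) Q hQ (toLocalFour F E c v (leviElt (UnitaryGroup.LocalRing E v) (UnitaryGroup.conjLocal E c v) (UnitaryGroup.conjLocal_conjLocal c v hcδ hδ) A₁)) ∈ K₀) (hKA₂ : FrameTransport.frameConj F E c v (2 + 2) hJ₂D (antidiagonal_over_eq_map F E 2) Q hQ (toLocalFour F E c v (leviElt (UnitaryGroup.LocalRing E v) (UnitaryGroup.conjLocal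 E c v) (UnitaryGroup.conjLocal_conjLocal c v hcδ hδ) A₂)) ∈ K₀)
    (hKu : ∀ t ∈ primePowBall (v.adicCompletion F) 0, FrameTransport.frameConj F E c v (2 + 2) hJ₂D (antidiagonal_over_eq_map F E 2) Q hQ (toLocalFour F E c v (uLongTwo (UnitaryGroup.LocalRing E v) (UnitaryGroup.conjLocal E c v) (UnitaryGroup.toLocalRing E v t * algebraMap E (UnitaryGroup.LocalRing E v) δ) (conjLocal_coord F E c hcδ v t))) ∈ K₀)
    (hKū : ∀ t ∈ primePowBall (v.adicCompletion F) 0, FrameTransport.frameConj F E c v (2 + 2) hJ₂D (antidiagonal_over_eq_map F E 2) Q hQ (toLocalFour F E c v (uLongTwo (UnitaryGroup.LocalRing E v) (UnitaryGroup.conjLocal E c v) (UnitaryGroup.toLocalRing E v t * algebraMap E (UnitaryGroup.LocalRing E v) δ⁻¹) (conjLocal_coord_inv F E c hcδ v t))) ∈ K₀)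
    (hKm₁ : ∀ ζ ∈ primePowBall (w₁.1.adicCompletion E) 0, FrameTransport.frameConj F E c v (2 + 2) hJ₂D (antidiagonal_over_eq_map F E 2) Q hQ (toLocalFour F E c v (uMinus (UnitaryGroup.LocalRing E v) (UnitaryGroup.conjLocal E c v) (UnitaryGroup.conjLocal_conjLocal c v hcδ hδ) (Pi.single w₁ ζ))) ∈ K₀) (hKm₂ : ∀ ζ ∈ primePowBall (w₂.1.adicCompletion E) 0, FrameTransport.frameConj F E c v (2 + 2) hJ₂D (antidiagonal_over_eq_map F E 2) Q hQ (toLocalFour F E c v (uMinus (UnitaryGroup.LocalRing E v) (UnitaryGroup.conjLocal E c v) (UnitaryGroup.conjLocal_conjLocal c v hcδ hδ) (Pi.single w₂ ζ))) ∈ K₀)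
    (hm₀ : localSiegelCharacter F E c v 2 χv s (weylDelta F E c v 2 hJ₂D (T₀ := T₂) * FrameTransport.frameConj F E c v (2 + 2) hJ₂D (antidiagonal_over_eq_map F E 2) Q hQ (toLocalFour F E c v (weylSiegel (UnitaryGroup.LocalRing E v) (UnitaryGroup.conjLocal E c v)))) = 1) (hC₁ : localSiegelCharacter F E c v 2 χv s (FrameTransport.frameConj F E c v (2 + 2) hJ₂D (antidiagonal_over_eq_map F E 2) Q hQ (toLocalFour F E c v (torusElt (UnitaryGroup.LocalRing E v) (UnitaryGroup.conjLocal E c v) (UnitaryGroup.conjLocal_conjLocal c v hcδ hδ) (1) (-((Units.mk0 δ hδ).map (algebraMap E (UnitaryGroup.LocalRing E v) : E →* UnitaryGroup.LocalRing E v))⁻¹)))) = 1) (hC₂₁ : ((χv w₁ (-1) : ℂˣ) : ℂ) = 1) (hC₂₂ : ((χv w₂ (-1) : ℂˣ) : ℂ) = 1) (hC₃ : (localSiegelCharacter F E c v 2 χv s (FrameTransport.frameConj F E c v (2 + 2) hJ₂D (antidiagonal_over_eq_map F E 2) Q hQ (toLocalFour F E c v (torusElt (UnitaryGroup.LocalRing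 E v) (UnitaryGroup.conjLocal E c v) (UnitaryGroup.conjLocal_conjLocal c v hcδ hδ) (-((Units.mk0 δ hδ).map (algebraMap E (UnitaryGroup.LocalRing E v) : E →* UnitaryGroup.LocalRing E v))⁻¹) (1)))) * ((∏ w' : PlacesOver E v, ‖algebraMap E (UnitaryGroup.LocalRing E v) δ w'‖ : ℝ) : ℂ)) = 1)
    (h : UnitaryGroup.localPi E c (2 + 2) J₂D v) (hh : h ∈ K₀) :
    localIntertwining F E c v 2 hJ₂D νN f h = aNorm F E c v 2 χv (νN.real {u : unipDeltaLocal F E c v 2 (JD := J₂D) | ∃ b₁ ∈ primePowBall (v.adicCompletion F) 0, ∃ ζ₁ ∈ primePowBall (w₁.1.adicCompletion E) 0, ∃ ζ₂ ∈ primePowBall (w₂.1.adicCompletion E) 0, ∃ b₂ ∈ primePowBall (v.adicCompletion F) 0, (u : UnitaryGroup.localPi E c (2 + 2) J₂D v) = FrameTransport.frameConj F E c v (2 + 2) hJ₂D (antidiagonal_over_eq_map F E 2) Q hQ (toLocalFour F E c v (nSiegel (UnitaryGroup.LocalRing E v) (UnitaryGroup.conjLocal E c v) (UnitaryGroup.conjLocal_conjLocal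 c v hcδ hδ) (UnitaryGroup.toLocalRing E v b₁ * algebraMap E (UnitaryGroup.LocalRing E v) δ) (Pi.single w₁ ζ₁ + Pi.single w₂ ζ₂) (UnitaryGroup.toLocalRing E v b₂ * algebraMap E (UnitaryGroup.LocalRing E v) δ) (conjLocal_coord F E c hcδ v b₁) (conjLocal_coord F E c hcδ v b₂)))}) s * f h := by
  rw [localIntertwining_eq_of_spherical_of_pair F E c hcδ hδ hd v hT₂ hJ₂D D Dinv hDD hDD' Q hQm hQ νN χv hχ K₀ hK₀ hs hSieg hsm hfK w₁ w₂ hne hw A₁ hA₁ A₂ hA₂ hKw₂ hKA₁ hKA₂ hKu hKū hKm₁ hKm₂ h hh, hm₀, hC₁, hC₂₁, hC₂₂, hC₃]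
  simp only [one_mul]
  rw [one_add_eq_lFactor_div_lFactor (chiF F E v χv) (norm_chiF_eq_one (F := F) (E := E) hχ) (by simp; linarith : 1 < (2 * s + 2).re),
    one_add_eq_lFactor_div_lFactor (chiNorm F E c v χv w₁) (norm_chiNorm_eq_one (F := F) (E := E) (c := c) hχ w₁) (by simp; linarith : 1 < (2 * s + 1).re),
    one_add_eq_lFactor_div_lFactor (chiNorm F E c v χv w₂) (norm_chiNorm_eq_one (F := F) (E := E) (c := c) hχ w₂) (by simp; linarith : 1 < (2 * s + 1).re),
    one_add_eq_lFactor_div_lFactor (chiF F E v χv) (norm_chiF_eq_one (F := F) (E := E) hχ) (by simp; linarith : 1 < (2 * s).re),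
    aNorm_two]
  -- the four ratios are `aNum 2 ∕ bDen 2`: `lF = L_F(·, χ_F)`, `lEN = L_{E_{w₁}} · L_{E_{w₂}}`
  have hlF : ∀ z : ℂ, lF F E v χv z = lFactor F v (chiF F E v χv) z := fun z => rfl
  have hlEN : ∀ z : ℂ, lEN F E c v χv z = lFactor E w₁.1 (chiNorm F E c v χv w₁) z * lFactor E w₂.1 (chiNorm F E c v χv w₂) z := fun z => by
    rw [lEN, Fintype.prod_eq_mul w₁ w₂ hne fun w' hw'' => ((hw w').elim (fun h' => absurd h' hw''.1) fun h' => absurd h' hw''.2)]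
  have h21 : (2 * s + 2 - 1 : ℂ) = 2 * s + 1 := by ring
  have h11 : (2 * s + 1 - 1 : ℂ) = 2 * s := by ring
  rw [h21, h11, hlF, hlF, hlF, hlF, hlEN, hlEN]
  have h0 : ∀ z : ℂ, 0 < z.re → lFactor F v (chiF F E v χv) z ≠ 0 := fun z hz => lFactor_ne_zero (norm_unramValue_le_one (norm_chiF_eq_one (F := F) (E := E) hχ)) hz
  have h0' : ∀ (w' : PlacesOver E v) (z : ℂ), 0 < z.re → lFactor E w'.1 (chiNorm F E c v χv w') z ≠ 0 := fun w' z hz =>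
    lFactor_ne_zero (norm_unramValue_le_one (norm_chiNorm_eq_one (F := F) (E := E) (c := c) hχ w')) hz
  have h1 := h0 (2 * s + 2) (by simp; linarith)
  have h2 := h0 (2 * s + 1) (by simp; linarith)
  have h3 := h0 (2 * s) (by simp; linarith)
  have h4 := h0' w₁ (2 * s + 1) (by simp; linarith)
  have h5 := h0' w₂ (2 * s + 1) (by simp; linarith)
  field_simp

end Summit.HodgeConjecture.HodgeConjecture.Cruxes.HLiu418.K2LiuSiegelCocycleSphericalValueSplit

end
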